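import Mathlib.CategoryTheory.Filtered.Final
import Mathlib.CategoryTheory.Limits.FullSubcategory
import Literature.AlgebraicGeometry.Motives.EtaleToProetDensity
import HarnessLib

/-!
# Bhatt–Scholze Lemma 5.1.1, second step, proved: the presheaf inverse image `Lan F` of an étale
# sheaf is a sheaf on the pro-étale affines (`isSheaf_lan_comp_proetAffineInclusion_holds`)

`EtaleToProetDensity.lean` isolated, as the named fact `isSheaf_lan_comp_proetAffineInclusion`,
the second step of the printed proof of Bhatt–Scholze Lemma 5.1.1 (arXiv p. 29: "The pullback `F'`
of `F` to `S` as a presheaf is given by `F'(B) = colim F(B_i)`. It thus suffices to check that `F'`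
is a sheaf"): for every abelian étale sheaf `F` on a scheme `X`, the restriction to `X_proét^aff`
(pro-étale affines, Def. 4.2.1) of the left Kan extension `Lan F` along `X_ét ⊂ X_proét` is a sheaf
for the topology induced from `X_proét`. This file **proves** it, on Mathlib's carriers and without
the locality-on-`X` / ind-étale reductions of the printed proof (which rest on Theorem 2.3.4):

* **Bhatt–Scholze Lemma 4.2.2 / Remark 4.2.3, proved** (`LevelIndex`, `LevelIndex.presentationPullback`,
  `isClosedUnderLimitsOfShape_isProetAffine`, `hasPullbacks_proetAffine`): for finitely many maps
  `f_m : V_m → W` of pro-étale affines with presentations `W = lim_i U_i`, `V_m = lim_k V_{m,k}`, the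
  *levels* — tuples `(i, (k_m), (a_m : V_{m,k_m} → U_i))` of étale `X`-morphisms through which the
  `f_m` factor — form a small cofiltered category (Stacks 01ZC: every `X`-morphism
  `lim_k V_{m,k} → U_i` factors through some `V_{m,k}`, uniquely up to refinement) whose projections
  to the index categories are initial, so that `W`, the `V_m` ("after changing the presentation",
  Lemma 4.2.2) and the fibre products `V_m ×_W V_{m'} = lim V_{m,k_m} ×_{U_i} V_{m',k_{m'}}`
  (cofiltered limits commute with fibre products) are presented over it; hence `X_proét^aff` is
  closed under fibre products in `X_proét` ("these agree with those in `Sch/X`").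
* **The sheaf condition for finite jointly surjective families of pro-étale affines**
  (`lan_ext`, `lan_exists_amalgamation`, `isSheafFor_lan_ofArrows`): with `(Lan F)(W) = colim F(U_i)`
  (Step A, `EtaleToProetLan.lean`), representatives `x̃_m ∈ F(V_{m,k_m})` of compatible sections at a
  common level satisfy the étale descent condition on the `V_{m,k_m} ×_{U_i} V_{m',k_{m'}}` at a deeper
  level, glue (`F` is an étale sheaf) over the open `O = ⋃_m im(a_m) ⊆ U_i`, and `O` contains the
  image of `W → U_i` (joint surjectivity), so that some `U_j → U_i` factors through `O` (Stacks 01ZC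
  again); the class of the glued section restricted to `U_j` is the amalgamation, and uniqueness is
  the same argument with étale separation.
* **The discharge** (`isSheaf_lan_comp_proetAffineInclusion_holds`): the induced topology is coarser
  than the restricted one (Mathlib `Functor.inducedTopology_le_restrictedTopology`), generated by the
  families of pro-étale affines whose images generate a pro-étale covering sieve; by
  `Precoverage.isSheaf_toGrothendieck_iff` it suffices to check the sheaf condition on pullbacks of
  generating families; a pro-étale covering sieve of the (quasi-compact) `W` contains a finite jointly
  surjective family (`exists_finite_of_mem_proEtTopology`: the pro-étale precoverage is quasi-compact),
  and base changes of such families along maps of pro-étale affines stay finite, jointly surjective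
  and pro-étale affine.

In particular Lemma 4.2.4 (`isCoverDense_proetAffineInclusion`) is *not* used: we prove the sheaf
property for a topology a priori finer than the induced one.

## References

* B. Bhatt, P. Scholze, *The pro-étale topology for schemes*, Astérisque 369 (2015)
  (arXiv:1309.1198, held; arXiv pages): Def. 4.2.1, Lemma 4.2.2 ("Any map in `X_proét^aff` is
  pro-(affine étale) … after changing the presentation for `U` we may assume …"), Remark 4.2.3
  ("`X_proét^aff` admits limits indexed by a connected diagram, and these agree with those in
  `Sch/X`"), p. 24; Lemma 5.1.1 and its proof, p. 29. [BhattScholze2015]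
* The Stacks Project, Tag 01ZC (morphisms from a cofiltered limit into a scheme locally of finite
  presentation factor through a stage), in Mathlib as `Scheme.preservesColimit_yoneda` and used
  through `ProetAffinePresentation.exists_fac` / `exists_comp_eq` of `EtaleToProetLan.lean`.
  [StacksProject]

## Design notes

* Morphisms of `X.ProEt`/`X.Etale` composed with cone legs over composite functors are not
  type-correct at `instances` transparency, which defeats `rw`; the file therefore works with
  cleanly typed wrappers (`ProetAffinePresentation.proj`, `lanLeg`, `LevelIndex.leg`, `liftFst`, …),
  makes the level-indexed presentations `reducible`, and sets
  `backward.isDefEq.respectTransparency false` (as Mathlib does around `pullback.map`).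
* Everything is for `Ab.{u+1}`-valued sheaves (the coefficients of `etaleToProetPullback`); filtered
  colimits of size `u` in `Ab.{u+1}` are computed on underlying sets
  (`preservesFilteredColimitsOfSize_forget_ab`).
* Mathlib searches: `Functor.restrictedTopology`, `Functor.inducedTopology_le_restrictedTopology`,
  `Precoverage.isSheaf_toGrothendieck_iff`, `Presieve.isSheafFor_subsieve`,
  `Presieve.isSheafFor_arrows_iff(_pullbacks)`, `Scheme.ofArrows_mem_smallEtaleTopology_iff`,
  `QuasiCompactCover.exists_isAffineOpen_of_isCompact`, `Scheme.compactSpace_of_isLimit`,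
  `Scheme.Pullback.exists_preimage_pullback`, `ObjectProperty.IsClosedUnderLimitsOfShape`,
  `Functor.Initial.isLimitWhiskerEquiv`, `Pi.initial_eval`, `IsCofiltered.cone`. Nothing restated;
  no new named fact.
-/

universe u

open CategoryTheory Limits Opposite AlgebraicGeometry

noncomputable section

set_option backward.isDefEq.respectTransparency false

namespace Literature.AlgebraicGeometry.Motives

variable {X : Scheme.{u}}

/-! ### Cleanly typed projections of a presentation -/

namespace ProetAffinePresentation

variable {W : X.ProEt} (𝔭 : ProetAffinePresentation X W)

/-- The projection `W → U_i` of a presentation, with its codomain written as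
`(etaleToProet X).obj (U_i)` (definitionally `𝔭.π.app i`; this form keeps rewriting usable).
[cite: BhattScholze2015, Def. 4.2.1] -/
def proj (i : 𝔭.ι) : W ⟶ (etaleToProet X).obj (𝔭.diagram.obj i) :=
  𝔭.π.app i

/-- `π_i ≫ U(a) = π_j`. [folklore] -/
@[reassoc (attr := simp)]
theorem proj_comp {i j : 𝔭.ι} (a : i ⟶ j) :
    𝔭.proj i ≫ (etaleToProet X).map (𝔭.diagram.map a) = 𝔭.proj j :=
  𝔭.π_comp a

/-- Every `X`-morphism `W → V`, `V ∈ X_ét`, factors through some `U_i` (Stacks 01ZC).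
[cite: StacksProject, Tag 01ZC] -/
theorem exists_proj_fac (V : X.Etale) (φ : W ⟶ (etaleToProet X).obj V) :
    ∃ (i : 𝔭.ι) (g : 𝔭.diagram.obj i ⟶ V), 𝔭.proj i ≫ (etaleToProet X).map g = φ :=
  𝔭.exists_fac V φ

/-- Two factorizations agree after refinement (Stacks 01ZC). [cite: StacksProject, Tag 01ZC] -/
theorem exists_proj_comp_eq (V : X.Etale) {i : 𝔭.ι} (g g' : 𝔭.diagram.obj i ⟶ V)
    (h : 𝔭.proj i ≫ (etaleToProet X).map g = 𝔭.proj i ≫ (etaleToProet X).map g') :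
    ∃ (j : 𝔭.ι) (a : j ⟶ i), 𝔭.diagram.map a ≫ g = 𝔭.diagram.map a ≫ g' :=
  𝔭.exists_comp_eq V g g' h

/-- Maps into `W` agreeing after every projection are equal. [folklore] -/
theorem hom_ext_proj {Z : X.ProEt} (g g' : Z ⟶ W) (h : ∀ i, g ≫ 𝔭.proj i = g' ≫ 𝔭.proj i) :
    g = g' :=
  𝔭.isLimitProEt.hom_ext h

/-- Re-indexing a presentation `W = lim_i U_i` along an initial functor `φ : T ⥤ ι` from a small
cofiltered category: `W = lim_t U_{φ t}` (Mathlib `Functor.Initial.isLimitWhiskerEquiv`).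
[cite: BhattScholze2015, Lemma 4.2.2] -/
@[reducible]
def reindex (T : Type u) [SmallCategory T] [IsCofiltered T] (φ : T ⥤ 𝔭.ι) [φ.Initial] :
    ProetAffinePresentation X W where
  ι := T
  diagram :=
    { obj := fun t => 𝔭.diagram.obj (φ.obj t)
      map := fun e => 𝔭.diagram.map (φ.map e)
      map_id := fun t => by rw [φ.map_id, 𝔭.diagram.map_id]
      map_comp := fun e e' => by rw [φ.map_comp, 𝔭.diagram.map_comp] }
  isAffine t := 𝔭.isAffine (φ.obj t)
  π := { app := fun t => 𝔭.π.app (φ.obj t)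
         naturality := fun _ _ e => 𝔭.π.naturality (φ.map e) }
  isLimit := (Functor.Initial.isLimitWhiskerEquiv φ _).symm 𝔭.isLimit

end ProetAffinePresentation

/-! ### A common level structure for finitely many maps into a pro-étale affine -/

section LevelIndex

variable {W : X.ProEt} (𝔭 : ProetAffinePresentation X W) {M : Type} {V : M → X.ProEt}
  (𝔮 : ∀ m, ProetAffinePresentation X (V m)) (f : ∀ m, V m ⟶ W)

/-- **Levels of a family of maps `f_m : V_m → W` of pro-étale affines** with presentations
`W = lim_i U_i`, `V_m = lim_k V_{m,k}`: an index `i`, indices `k_m`, and étale `X`-morphisms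
`a_m : V_{m,k_m} → U_i` through which the `f_m` factor:
`(V_m → V_{m,k_m} → U_i) = (V_m → W → U_i)`. These form a small cofiltered category over which all
the `V_m`, `W` — and the fibre products `V_m ×_W V_{m'}` — are simultaneously presented with
level maps (Bhatt–Scholze Lemma 4.2.2: "after changing the presentation … we may assume"; every
`X`-morphism `lim_k V_k → U_i` factors through some `V_k`, EGA IV 8.13.1 / Stacks 01ZC).
[cite: BhattScholze2015, Lemma 4.2.2] -/
structure LevelIndex where
  /-- the level of `W` -/
  i : 𝔭.ι
  /-- the levels of the `V_m` -/
  k : ∀ m, (𝔮 m).ι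
  /-- the level maps `a_m : V_{m,k_m} → U_i` -/
  a : ∀ m, (𝔮 m).diagram.obj (k m) ⟶ 𝔭.diagram.obj i
  /-- `f_m` factors through `a_m` -/
  w : ∀ m, (𝔮 m).proj (k m) ≫ (etaleToProet X).map (a m) = f m ≫ 𝔭.proj i

namespace LevelIndex

variable {𝔭 𝔮 f}

attribute [reassoc] LevelIndex.w

/-- Morphisms of levels: transition maps commuting with the level maps.
[cite: BhattScholze2015, Lemma 4.2.2] -/
@[ext]
structure Hom (t t' : LevelIndex 𝔭 𝔮 f) where
  /-- the transition on the level of `W` -/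
  hi : t.i ⟶ t'.i
  /-- the transitions on the levels of the `V_m` -/
  hk : ∀ m, t.k m ⟶ t'.k m
  /-- compatibility with the level maps -/
  w : ∀ m, t.a m ≫ 𝔭.diagram.map hi = (𝔮 m).diagram.map (hk m) ≫ t'.a m := by cat_disch

attribute [reassoc] Hom.w

/-- Levels form a small category. [cite: BhattScholze2015, Lemma 4.2.2] -/
instance : SmallCategory (LevelIndex 𝔭 𝔮 f) where
  Hom := Hom
  id t := { hi := 𝟙 _, hk := fun _ => 𝟙 _ }
  comp φ ψ :=
    { hi := φ.hi ≫ ψ.hi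
      hk := fun m => φ.hk m ≫ ψ.hk m
      w := fun m => by rw [Functor.map_comp, φ.w_assoc, ψ.w, Functor.map_comp, Category.assoc] }

/-- Morphisms of levels are determined by their transition maps. [folklore] -/
@[ext]
theorem hom_ext {t t' : LevelIndex 𝔭 𝔮 f} (φ ψ : t ⟶ t') (h₁ : φ.hi = ψ.hi)
    (h₂ : ∀ m, φ.hk m = ψ.hk m) : φ = ψ :=
  Hom.ext h₁ (funext h₂)

/-- The identity level morphism on the `W`-level (by `rfl`). [folklore] -/
@[simp] theorem id_hi (t : LevelIndex 𝔭 𝔮 f) : Hom.hi (𝟙 t) = 𝟙 t.i := rfl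

/-- The identity level morphism on the `V_m`-levels (by `rfl`). [folklore] -/
@[simp] theorem id_hk (t : LevelIndex 𝔭 𝔮 f) (m : M) : Hom.hk (𝟙 t) m = 𝟙 (t.k m) := rfl

/-- Composition of level morphisms on the `W`-level (by `rfl`). [folklore] -/
@[simp] theorem comp_hi {t₁ t₂ t₃ : LevelIndex 𝔭 𝔮 f} (φ : t₁ ⟶ t₂) (ψ : t₂ ⟶ t₃) :
    Hom.hi (φ ≫ ψ) = φ.hi ≫ ψ.hi := rfl

/-- Composition of level morphisms on the `V_m`-levels (by `rfl`). [folklore] -/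
@[simp] theorem comp_hk {t₁ t₂ t₃ : LevelIndex 𝔭 𝔮 f} (φ : t₁ ⟶ t₂) (ψ : t₂ ⟶ t₃) (m : M) :
    Hom.hk (φ ≫ ψ) m = φ.hk m ≫ ψ.hk m := rfl

/-- Level morphisms commute with the level maps. [folklore] -/
@[reassoc]
theorem hom_w {t t' : LevelIndex 𝔭 𝔮 f} (φ : t ⟶ t') (m : M) :
    t.a m ≫ 𝔭.diagram.map φ.hi = (𝔮 m).diagram.map (φ.hk m) ≫ t'.a m :=
  Hom.w φ m

/-- A level map `V_{m,k} → U_i` exists for every `m` and `i` (Stacks 01ZC).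
[cite: StacksProject, Tag 01ZC] -/
theorem exists_level (m : M) (i : 𝔭.ι) :
    ∃ (k : (𝔮 m).ι) (a : (𝔮 m).diagram.obj k ⟶ 𝔭.diagram.obj i),
      (𝔮 m).proj k ≫ (etaleToProet X).map a = f m ≫ 𝔭.proj i :=
  (𝔮 m).exists_proj_fac _ (f m ≫ 𝔭.proj i)

/-- Two level maps out of the same `V_{m,k}` into `U_i` agree after refining `k` (Stacks 01ZC).
[cite: StacksProject, Tag 01ZC] -/
theorem exists_level_eq (m : M) (i : 𝔭.ι) {k : (𝔮 m).ι}
    (a a' : (𝔮 m).diagram.obj k ⟶ 𝔭.diagram.obj i)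
    (w : (𝔮 m).proj k ≫ (etaleToProet X).map a = f m ≫ 𝔭.proj i)
    (w' : (𝔮 m).proj k ≫ (etaleToProet X).map a' = f m ≫ 𝔭.proj i) :
    ∃ (k' : (𝔮 m).ι) (e : k' ⟶ k), (𝔮 m).diagram.map e ≫ a = (𝔮 m).diagram.map e ≫ a' :=
  (𝔮 m).exists_proj_comp_eq _ a a' (w.trans w'.symm)

/-- Refining the source of a level map keeps it a level map. [folklore] -/
theorem level_w_of_comp (m : M) (i : 𝔭.ι) {k k' : (𝔮 m).ι} (e : k' ⟶ k)
    (a : (𝔮 m).diagram.obj k ⟶ 𝔭.diagram.obj i)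
    (w : (𝔮 m).proj k ≫ (etaleToProet X).map a = f m ≫ 𝔭.proj i) :
    (𝔮 m).proj k' ≫ (etaleToProet X).map ((𝔮 m).diagram.map e ≫ a) = f m ≫ 𝔭.proj i := by
  rw [Functor.map_comp, (𝔮 m).proj_comp_assoc, w]

/-- Composing a level map with a transition map of `W` keeps it a level map. [folklore] -/
theorem level_w_comp (m : M) {i i' : 𝔭.ι} (c : i ⟶ i') {k : (𝔮 m).ι}
    (a : (𝔮 m).diagram.obj k ⟶ 𝔭.diagram.obj i)
    (w : (𝔮 m).proj k ≫ (etaleToProet X).map a = f m ≫ 𝔭.proj i) :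
    (𝔮 m).proj k ≫ (etaleToProet X).map (a ≫ 𝔭.diagram.map c) = f m ≫ 𝔭.proj i' := by
  rw [Functor.map_comp, reassoc_of% w, 𝔭.proj_comp]

/-- **One constraint**: a level map `a : V_{m,k} → U_i` can be refined so as to lie over a given
level map `a₁ : V_{m,k₁} → U_{i₁}` along `c : i → i₁`. [cite: StacksProject, Tag 01ZC] -/
theorem exists_level_over (m : M) {i i₁ : 𝔭.ι} (c : i ⟶ i₁) {k k₁ : (𝔮 m).ι}
    (a : (𝔮 m).diagram.obj k ⟶ 𝔭.diagram.obj i)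
    (w : (𝔮 m).proj k ≫ (etaleToProet X).map a = f m ≫ 𝔭.proj i)
    (a₁ : (𝔮 m).diagram.obj k₁ ⟶ 𝔭.diagram.obj i₁)
    (w₁ : (𝔮 m).proj k₁ ≫ (etaleToProet X).map a₁ = f m ≫ 𝔭.proj i₁) :
    ∃ (k' : (𝔮 m).ι) (e : k' ⟶ k) (e₁ : k' ⟶ k₁),
      ((𝔮 m).diagram.map e ≫ a) ≫ 𝔭.diagram.map c = (𝔮 m).diagram.map e₁ ≫ a₁ := by
  obtain ⟨k', e', h⟩ := exists_level_eq (𝔭 := 𝔭) (𝔮 := 𝔮) (f := f) m i₁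
    ((𝔮 m).diagram.map (IsCofiltered.minToLeft k k₁) ≫ a ≫ 𝔭.diagram.map c)
    ((𝔮 m).diagram.map (IsCofiltered.minToRight k k₁) ≫ a₁)
    (level_w_of_comp m i₁ _ _ (level_w_comp m c a w)) (level_w_of_comp m i₁ _ _ w₁)
  refine ⟨k', e' ≫ IsCofiltered.minToLeft k k₁, e' ≫ IsCofiltered.minToRight k k₁, ?_⟩
  simpa only [Functor.map_comp, Category.assoc] using h

/-- There is a level. [cite: BhattScholze2015, Lemma 4.2.2] -/
instance nonempty : Nonempty (LevelIndex 𝔭 𝔮 f) := by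
  obtain ⟨i⟩ := IsCofiltered.nonempty (C := 𝔭.ι)
  choose k a w using fun m => exists_level (𝔭 := 𝔭) (𝔮 := 𝔮) (f := f) m i
  exact ⟨⟨i, k, a, w⟩⟩

/-- Any two levels are dominated by a third. [cite: BhattScholze2015, Lemma 4.2.2] -/
theorem cone_objs (t₁ t₂ : LevelIndex 𝔭 𝔮 f) :
    ∃ (t : LevelIndex 𝔭 𝔮 f) (_ : t ⟶ t₁) (_ : t ⟶ t₂), True := by
  let i := IsCofiltered.min t₁.i t₂.i
  have key : ∀ m, ∃ (k : (𝔮 m).ι) (a : (𝔮 m).diagram.obj k ⟶ 𝔭.diagram.obj i)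
      (e₁ : k ⟶ t₁.k m) (e₂ : k ⟶ t₂.k m),
      (𝔮 m).proj k ≫ (etaleToProet X).map a = f m ≫ 𝔭.proj i ∧
      a ≫ 𝔭.diagram.map (IsCofiltered.minToLeft t₁.i t₂.i) = (𝔮 m).diagram.map e₁ ≫ t₁.a m ∧
      a ≫ 𝔭.diagram.map (IsCofiltered.minToRight t₁.i t₂.i) =
        (𝔮 m).diagram.map e₂ ≫ t₂.a m := by
    intro m
    obtain ⟨k₀, a₀, w₀⟩ := exists_level (𝔭 := 𝔭) (𝔮 := 𝔮) (f := f) m i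
    obtain ⟨k₁, e, e₁, h₁⟩ := exists_level_over m (IsCofiltered.minToLeft t₁.i t₂.i) a₀ w₀
      (t₁.a m) (t₁.w m)
    obtain ⟨k₂, e', e₂, h₂⟩ := exists_level_over m (IsCofiltered.minToRight t₁.i t₂.i)
      ((𝔮 m).diagram.map e ≫ a₀) (level_w_of_comp m i e a₀ w₀) (t₂.a m) (t₂.w m)
    refine ⟨k₂, (𝔮 m).diagram.map e' ≫ (𝔮 m).diagram.map e ≫ a₀, e' ≫ e₁, e₂,
      ?_, ?_, by simpa only [Category.assoc] using h₂⟩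
    · simpa only [Functor.map_comp, Category.assoc] using
        level_w_of_comp m i (e' ≫ e) a₀ w₀
    · simp only [Functor.map_comp, Category.assoc] at h₁ ⊢
      rw [h₁]
  choose k a e₁ e₂ w h₁ h₂ using key
  exact ⟨⟨i, k, a, w⟩, ⟨IsCofiltered.minToLeft _ _, e₁, h₁⟩, ⟨IsCofiltered.minToRight _ _, e₂, h₂⟩,
    trivial⟩

/-- Any two parallel morphisms of levels are equalized by a third. [cite: BhattScholze2015, Lemma 4.2.2] -/
theorem cone_maps {t₁ t₂ : LevelIndex 𝔭 𝔮 f} (φ ψ : t₁ ⟶ t₂) :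
    ∃ (t : LevelIndex 𝔭 𝔮 f) (τ : t ⟶ t₁), τ ≫ φ = τ ≫ ψ := by
  let i := IsCofiltered.eq φ.hi ψ.hi
  let c : i ⟶ t₁.i := IsCofiltered.eqHom φ.hi ψ.hi
  have key : ∀ m, ∃ (k : (𝔮 m).ι) (a : (𝔮 m).diagram.obj k ⟶ 𝔭.diagram.obj i)
      (e : k ⟶ IsCofiltered.eq (φ.hk m) (ψ.hk m)),
      (𝔮 m).proj k ≫ (etaleToProet X).map a = f m ≫ 𝔭.proj i ∧
      a ≫ 𝔭.diagram.map c =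
        (𝔮 m).diagram.map (e ≫ IsCofiltered.eqHom (φ.hk m) (ψ.hk m)) ≫ t₁.a m := by
    intro m
    obtain ⟨k₀, a₀, w₀⟩ := exists_level (𝔭 := 𝔭) (𝔮 := 𝔮) (f := f) m i
    obtain ⟨k₁, e, e₁, h₁⟩ := exists_level_over m c a₀ w₀
      ((𝔮 m).diagram.map (IsCofiltered.eqHom (φ.hk m) (ψ.hk m)) ≫ t₁.a m)
      (level_w_of_comp m t₁.i _ _ (t₁.w m))
    exact ⟨k₁, (𝔮 m).diagram.map e ≫ a₀, e₁, level_w_of_comp m i e a₀ w₀,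
      by simpa only [Functor.map_comp, Category.assoc] using h₁⟩
  choose k a e w h using key
  refine ⟨⟨i, k, a, w⟩, ⟨c, fun m => e m ≫ IsCofiltered.eqHom (φ.hk m) (ψ.hk m), h⟩, ?_⟩
  ext
  · exact IsCofiltered.eq_condition φ.hi ψ.hi
  · simp only [comp_hk, Category.assoc]
    rw [IsCofiltered.eq_condition]

/-- Levels admit cones over pairs of objects and over parallel pairs. [cite: BhattScholze2015, Lemma 4.2.2] -/
instance isCofilteredOrEmpty : IsCofilteredOrEmpty (LevelIndex 𝔭 𝔮 f) where
  cone_objs := cone_objs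
  cone_maps _ _ φ ψ := cone_maps φ ψ

/-- **The category of levels is cofiltered** (and nonempty). [cite: BhattScholze2015, Lemma 4.2.2] -/
instance isCofiltered : IsCofiltered (LevelIndex 𝔭 𝔮 f) where

/-- The level of `W`. [cite: BhattScholze2015, Lemma 4.2.2] -/
@[reducible]
def projW : LevelIndex 𝔭 𝔮 f ⥤ 𝔭.ι where
  obj t := t.i
  map φ := φ.hi

/-- The levels of all the `V_m` at once. [cite: BhattScholze2015, Lemma 4.2.2] -/
@[reducible]
def projAll : LevelIndex 𝔭 𝔮 f ⥤ (∀ m, (𝔮 m).ι) where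
  obj t := t.k
  map φ := φ.hk

/-- The level of `V_m`. [cite: BhattScholze2015, Lemma 4.2.2] -/
@[reducible]
def projV (m : M) : LevelIndex 𝔭 𝔮 f ⥤ (𝔮 m).ι where
  obj t := t.k m
  map φ := φ.hk m

/-- `t ↦ k_m` is `t ↦ (k_m)_m` followed by evaluation at `m`. [folklore] -/
def projVIso (m : M) : projAll ⋙ Pi.eval _ m ≅ projV (𝔭 := 𝔭) (𝔮 := 𝔮) (f := f) m :=
  NatIso.ofComponents (fun _ => Iso.refl _)

/-- Refining all the `V`-levels of a level along given transition maps. [folklore] -/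
def refine (t : LevelIndex 𝔭 𝔮 f) (k : ∀ m, (𝔮 m).ι) (e : ∀ m, k m ⟶ t.k m) :
    LevelIndex 𝔭 𝔮 f where
  i := t.i
  k := k
  a m := (𝔮 m).diagram.map (e m) ≫ t.a m
  w m := level_w_of_comp m t.i (e m) (t.a m) (t.w m)

/-- The refinement maps to the original level. [folklore] -/
def refineHom (t : LevelIndex 𝔭 𝔮 f) (k : ∀ m, (𝔮 m).ι) (e : ∀ m, k m ⟶ t.k m) :
    t.refine k e ⟶ t where
  hi := 𝟙 _
  hk := e
  w m := by simp [refine]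

/-- **`t ↦ i` is initial.** [cite: BhattScholze2015, Lemma 4.2.2] -/
instance initial_projW : (projW (𝔭 := 𝔭) (𝔮 := 𝔮) (f := f)).Initial := by
  refine Functor.initial_of_exists_of_isCofiltered _ (fun i => ?_) (fun {i t} s s' => ?_)
  · choose k a w using fun m => exists_level (𝔭 := 𝔭) (𝔮 := 𝔮) (f := f) m i
    exact ⟨⟨i, k, a, w⟩, ⟨𝟙 i⟩⟩
  · let i₀ := IsCofiltered.eq s s'
    let c : i₀ ⟶ t.i := IsCofiltered.eqHom s s'
    have key : ∀ m, ∃ (k : (𝔮 m).ι) (a : (𝔮 m).diagram.obj k ⟶ 𝔭.diagram.obj i₀)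
        (e : k ⟶ t.k m), (𝔮 m).proj k ≫ (etaleToProet X).map a = f m ≫ 𝔭.proj i₀ ∧
        a ≫ 𝔭.diagram.map c = (𝔮 m).diagram.map e ≫ t.a m := by
      intro m
      obtain ⟨k₀, a₀, w₀⟩ := exists_level (𝔭 := 𝔭) (𝔮 := 𝔮) (f := f) m i₀
      obtain ⟨k₁, e, e₁, h₁⟩ := exists_level_over m c a₀ w₀ (t.a m) (t.w m)
      exact ⟨k₁, (𝔮 m).diagram.map e ≫ a₀, e₁, level_w_of_comp m i₀ e a₀ w₀, h₁⟩
    choose k a e w h using key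
    exact ⟨⟨i₀, k, a, w⟩, ⟨c, e, h⟩, IsCofiltered.eq_condition s s'⟩

/-- **`t ↦ (k_m)_m` is initial.** [cite: BhattScholze2015, Lemma 4.2.2] -/
instance initial_projAll : (projAll (𝔭 := 𝔭) (𝔮 := 𝔮) (f := f)).Initial := by
  refine Functor.initial_of_exists_of_isCofiltered _ (fun k => ?_) (fun {k t} s s' => ?_)
  · obtain ⟨t⟩ := (inferInstance : Nonempty (LevelIndex 𝔭 𝔮 f))
    exact ⟨t.refine (fun m => IsCofiltered.min (k m) (t.k m))
      (fun m => IsCofiltered.minToRight _ _), ⟨fun m => IsCofiltered.minToLeft _ _⟩⟩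
  · refine ⟨t.refine (fun m => IsCofiltered.eq (s m) (s' m))
      (fun m => IsCofiltered.eqHom (s m) (s' m)), t.refineHom _ _, ?_⟩
    funext m
    exact IsCofiltered.eq_condition (s m) (s' m)

/-- **`t ↦ k_m` is initial.** [cite: BhattScholze2015, Lemma 4.2.2] -/
instance initial_projV (m : M) : (projV (𝔭 := 𝔭) (𝔮 := 𝔮) (f := f) m).Initial :=
  Functor.initial_of_natIso (projVIso m)

/-! ### The presentations over the category of levels -/

/-- `W = lim_t U_{i(t)}` re-indexed over the levels. [cite: BhattScholze2015, Lemma 4.2.2] -/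
@[reducible]
def presentationW : ProetAffinePresentation X W :=
  𝔭.reindex (LevelIndex 𝔭 𝔮 f) projW

/-- `V_m = lim_t V_{m,k_m(t)}` re-indexed over the levels. [cite: BhattScholze2015, Lemma 4.2.2] -/
@[reducible]
def presentationV (m : M) : ProetAffinePresentation X (V m) :=
  (𝔮 m).reindex (LevelIndex 𝔭 𝔮 f) (projV m)

/-! ### The levelwise fibre product `V_m ×_W V_{m'} = lim_t V_{m,k_m(t)} ×_{U_{i(t)}} V_{m',k_{m'}(t)}` -/

section Pullback

variable (m m' : M)

/-- The levelwise fibre products `t ↦ V_{m,k_m} ×_{U_i} V_{m',k_{m'}}` (affine étale `X`-schemes).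
[cite: BhattScholze2015, Remark 4.2.3] -/
@[reducible]
def pullbackDiagram : LevelIndex 𝔭 𝔮 f ⥤ X.Etale where
  obj t := pullback (t.a m) (t.a m')
  map {t t'} φ := pullback.map _ _ _ _ ((𝔮 m).diagram.map (φ.hk m)) ((𝔮 m').diagram.map (φ.hk m'))
    (𝔭.diagram.map φ.hi) (φ.w m) (φ.w m')
  map_id t := by ext <;> simp
  map_comp φ ψ := by
    rw [pullback.map_comp]
    congr 1 <;> simp

/-- The transition maps of the levelwise fibre products commute with the first projections.
[folklore] -/
@[reassoc (attr := simp)]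
theorem pullbackDiagram_map_fst {t t' : LevelIndex 𝔭 𝔮 f} (φ : t ⟶ t') :
    (pullbackDiagram m m').map φ ≫ pullback.fst (t'.a m) (t'.a m') =
      pullback.fst (t.a m) (t.a m') ≫ (𝔮 m).diagram.map (φ.hk m) :=
  pullback.lift_fst _ _ _

/-- The transition maps of the levelwise fibre products commute with the second projections.
[folklore] -/
@[reassoc (attr := simp)]
theorem pullbackDiagram_map_snd {t t' : LevelIndex 𝔭 𝔮 f} (φ : t ⟶ t') :
    (pullbackDiagram m m').map φ ≫ pullback.snd (t'.a m) (t'.a m') =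
      pullback.snd (t.a m) (t.a m') ≫ (𝔮 m').diagram.map (φ.hk m') :=
  pullback.lift_snd _ _ _

/-- The fibre products of the level maps agree on `V_m ×_W V_{m'}`. [folklore] -/
theorem pullback_condition_level (t : LevelIndex 𝔭 𝔮 f) :
    (pullback.fst (f m) (f m') ≫ (𝔮 m).proj (t.k m)) ≫ (etaleToProet X).map (t.a m) =
      (pullback.snd (f m) (f m') ≫ (𝔮 m').proj (t.k m')) ≫ (etaleToProet X).map (t.a m') := by
  rw [Category.assoc, t.w m, Category.assoc, t.w m', pullback.condition_assoc]

/-- The projections `V_m ×_W V_{m'} → V_{m,k_m} ×_{U_i} V_{m',k_{m'}}`. [cite: BhattScholze2015, Remark 4.2.3] -/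
def pullbackProj (t : LevelIndex 𝔭 𝔮 f) :
    pullback (f m) (f m') ⟶ (etaleToProet X).obj (pullback (t.a m) (t.a m')) :=
  pullback.lift (pullback.fst (f m) (f m') ≫ (𝔮 m).proj (t.k m))
      (pullback.snd (f m) (f m') ≫ (𝔮 m').proj (t.k m')) (pullback_condition_level m m' t) ≫
    (PreservesPullback.iso (etaleToProet X) (t.a m) (t.a m')).inv

/-- The projection to a levelwise fibre product followed by the first projection. [folklore] -/
@[reassoc]
theorem pullbackProj_fst (t : LevelIndex 𝔭 𝔮 f) :
    pullbackProj m m' t ≫ (etaleToProet X).map (pullback.fst (t.a m) (t.a m')) =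
      pullback.fst (f m) (f m') ≫ (𝔮 m).proj (t.k m) := by
  rw [pullbackProj, Category.assoc, PreservesPullback.iso_inv_fst, pullback.lift_fst]

/-- The projection to a levelwise fibre product followed by the second projection. [folklore] -/
@[reassoc]
theorem pullbackProj_snd (t : LevelIndex 𝔭 𝔮 f) :
    pullbackProj m m' t ≫ (etaleToProet X).map (pullback.snd (t.a m) (t.a m')) =
      pullback.snd (f m) (f m') ≫ (𝔮 m').proj (t.k m') := by
  rw [pullbackProj, Category.assoc, PreservesPullback.iso_inv_snd, pullback.lift_snd]

/-- Maps into the image of a levelwise fibre product are determined by the two projections.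
[folklore] -/
theorem hom_ext_level {Z : X.ProEt} (t : LevelIndex 𝔭 𝔮 f)
    (g g' : Z ⟶ (etaleToProet X).obj (pullback (t.a m) (t.a m')))
    (h₁ : g ≫ (etaleToProet X).map (pullback.fst (t.a m) (t.a m')) =
      g' ≫ (etaleToProet X).map (pullback.fst (t.a m) (t.a m')))
    (h₂ : g ≫ (etaleToProet X).map (pullback.snd (t.a m) (t.a m')) =
      g' ≫ (etaleToProet X).map (pullback.snd (t.a m) (t.a m'))) : g = g' :=
  PullbackCone.IsLimit.hom_ext
    (isLimitPullbackConeMapOfIsLimit (etaleToProet X) _ (pullbackIsPullback (t.a m) (t.a m')))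
    h₁ h₂

/-- The projections are compatible with the transition maps. [folklore] -/
@[reassoc]
theorem pullbackProj_comp {t t' : LevelIndex 𝔭 𝔮 f} (φ : t ⟶ t') :
    pullbackProj m m' t ≫ (etaleToProet X).map ((pullbackDiagram m m').map φ) =
      pullbackProj m m' t' := by
  apply hom_ext_level
  · rw [Category.assoc, ← Functor.map_comp, pullbackDiagram_map_fst, Functor.map_comp,
      pullbackProj_fst_assoc, pullbackProj_fst, (𝔮 m).proj_comp]
  · rw [Category.assoc, ← Functor.map_comp, pullbackDiagram_map_snd, Functor.map_comp,
      pullbackProj_snd_assoc, pullbackProj_snd, (𝔮 m').proj_comp]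

/-- The cone `V_m ×_W V_{m'} → V_{m,k_m} ×_{U_i} V_{m',k_{m'}}`. [cite: BhattScholze2015, Remark 4.2.3] -/
def pullbackCone :
    (Functor.const (LevelIndex 𝔭 𝔮 f)).obj (pullback (f m) (f m')) ⟶
      pullbackDiagram m m' ⋙ etaleToProet X where
  app t := pullbackProj m m' t
  naturality _ _ φ := (Category.id_comp _).trans (pullbackProj_comp m m' φ).symm

/-- The first projections `V_{m,k_m} ×_{U_i} V_{m',k_{m'}} → V_{m,k_m}`, naturally in the level.
[folklore] -/
@[simps]
def fstNatTrans : pullbackDiagram (𝔭 := 𝔭) (𝔮 := 𝔮) (f := f) m m' ⟶ projV m ⋙ (𝔮 m).diagram where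
  app t := pullback.fst (t.a m) (t.a m')
  naturality _ _ φ := pullbackDiagram_map_fst m m' φ

/-- The second projections `V_{m,k_m} ×_{U_i} V_{m',k_{m'}} → V_{m',k_{m'}}`, naturally in the
level. [folklore] -/
@[simps]
def sndNatTrans : pullbackDiagram (𝔭 := 𝔭) (𝔮 := 𝔮) (f := f) m m' ⟶ projV m' ⋙ (𝔮 m').diagram where
  app t := pullback.snd (t.a m) (t.a m')
  naturality _ _ φ := pullbackDiagram_map_snd m m' φ

variable {m m'} (s : Cone ((pullbackDiagram (𝔭 := 𝔭) (𝔮 := 𝔮) (f := f) m m' ⋙ etaleToProet X) ⋙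
    Scheme.ProEt.forget X))

/-- The legs of a cone over the levelwise fibre products, cleanly typed. [folklore] -/
def leg (t : LevelIndex 𝔭 𝔮 f) :
    s.pt ⟶ (Scheme.ProEt.forget X).obj ((etaleToProet X).obj (pullback (t.a m) (t.a m'))) :=
  s.π.app t

/-- A cone over the levelwise fibre products (as `X`-schemes) restricts to a cone over the
`V_{m,k_m(t)}`. [folklore] -/
abbrev coneFst :
    Cone (((presentationV (𝔭 := 𝔭) (𝔮 := 𝔮) (f := f) m).diagram ⋙ etaleToProet X) ⋙
      Scheme.ProEt.forget X) :=
  (Cone.postcompose (Functor.whiskerRight (Functor.whiskerRight (fstNatTrans m m')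
    (etaleToProet X)) (Scheme.ProEt.forget X))).obj s

/-- A cone over the levelwise fibre products (as `X`-schemes) restricts to a cone over the
`V_{m',k_{m'}(t)}`. [folklore] -/
abbrev coneSnd :
    Cone (((presentationV (𝔭 := 𝔭) (𝔮 := 𝔮) (f := f) m').diagram ⋙ etaleToProet X) ⋙
      Scheme.ProEt.forget X) :=
  (Cone.postcompose (Functor.whiskerRight (Functor.whiskerRight (sndNatTrans m m')
    (etaleToProet X)) (Scheme.ProEt.forget X))).obj s

/-- The lift `s.pt → V_m` of the first restricted cone, cleanly typed. [folklore] -/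
def liftFst : s.pt ⟶ (Scheme.ProEt.forget X).obj (V m) :=
  (presentationV m).isLimit.lift (coneFst s)

/-- The lift `s.pt → V_{m'}` of the second restricted cone, cleanly typed. [folklore] -/
def liftSnd : s.pt ⟶ (Scheme.ProEt.forget X).obj (V m') :=
  (presentationV m').isLimit.lift (coneSnd s)

/-- The lift to `V_m` followed by a projection of `V_m`. [folklore] -/
@[reassoc]
theorem liftFst_proj (t : LevelIndex 𝔭 𝔮 f) :
    liftFst s ≫ (Scheme.ProEt.forget X).map ((𝔮 m).proj (t.k m)) =
      leg s t ≫ (Scheme.ProEt.forget X).map ((etaleToProet X).map (pullback.fst (t.a m) (t.a m'))) :=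
  (presentationV m).isLimit.fac (coneFst s) t

/-- The lift to `V_{m'}` followed by a projection of `V_{m'}`. [folklore] -/
@[reassoc]
theorem liftSnd_proj (t : LevelIndex 𝔭 𝔮 f) :
    liftSnd s ≫ (Scheme.ProEt.forget X).map ((𝔮 m').proj (t.k m')) =
      leg s t ≫ (Scheme.ProEt.forget X).map ((etaleToProet X).map (pullback.snd (t.a m) (t.a m'))) :=
  (presentationV m').isLimit.fac (coneSnd s) t

/-- The lifts of the two restricted cones agree over `W`. [folklore] -/
theorem liftFst_comp_eq :
    liftFst s ≫ (Scheme.ProEt.forget X).map (f m) = liftSnd s ≫ (Scheme.ProEt.forget X).map (f m') := by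
  refine (presentationW (𝔭 := 𝔭) (𝔮 := 𝔮) (f := f)).isLimit.hom_ext fun t => ?_
  change (liftFst s ≫ (Scheme.ProEt.forget X).map (f m)) ≫ (Scheme.ProEt.forget X).map (𝔭.proj t.i) =
    (liftSnd s ≫ (Scheme.ProEt.forget X).map (f m')) ≫ (Scheme.ProEt.forget X).map (𝔭.proj t.i)
  rw [Category.assoc, Category.assoc, ← Functor.map_comp, ← Functor.map_comp, ← t.w m, ← t.w m',
    Functor.map_comp, Functor.map_comp, liftFst_proj_assoc, liftSnd_proj_assoc,
    ← Functor.map_comp, ← Functor.map_comp, ← Functor.map_comp, ← Functor.map_comp,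
    pullback.condition]

/-- The lift of a cone over the levelwise fibre products to `V_m ×_W V_{m'}`. [folklore] -/
def pullbackLift : s.pt ⟶ (Scheme.ProEt.forget X).obj (pullback (f m) (f m')) :=
  PullbackCone.IsLimit.lift
    (isLimitPullbackConeMapOfIsLimit (Scheme.ProEt.forget X) _ (pullbackIsPullback (f m) (f m')))
    (liftFst s) (liftSnd s) (liftFst_comp_eq s)

/-- The lift to the fibre product followed by the first projection. [folklore] -/
@[reassoc]
theorem pullbackLift_fst :
    pullbackLift s ≫ (Scheme.ProEt.forget X).map (pullback.fst (f m) (f m')) = liftFst s :=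
  PullbackCone.IsLimit.lift_fst _ _ _ _

/-- The lift to the fibre product followed by the second projection. [folklore] -/
@[reassoc]
theorem pullbackLift_snd :
    pullbackLift s ≫ (Scheme.ProEt.forget X).map (pullback.snd (f m) (f m')) = liftSnd s :=
  PullbackCone.IsLimit.lift_snd _ _ _ _

variable (m m')

/-- **`V_m ×_W V_{m'} = lim_t V_{m,k_m(t)} ×_{U_{i(t)}} V_{m',k_{m'}(t)}` as `X`-schemes**: cofiltered
limits commute with fibre products (Bhatt–Scholze Remark 4.2.3: "`X_proét^aff` admits limits indexed
by a connected diagram, and these agree with those in `Sch/X`"). [cite: BhattScholze2015, Remark 4.2.3] -/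
def isLimitPullbackCone :
    IsLimit ((Scheme.ProEt.forget X).mapCone (Cone.mk (pullback (f m) (f m'))
      (pullbackCone (𝔭 := 𝔭) (𝔮 := 𝔮) (f := f) m m'))) where
  lift s := pullbackLift s
  fac s t := by
    change pullbackLift s ≫ (Scheme.ProEt.forget X).map (pullbackProj m m' t) = leg s t
    apply PullbackCone.IsLimit.hom_ext (isLimitPullbackConeMapOfIsLimit
      (etaleToProet X ⋙ Scheme.ProEt.forget X) _ (pullbackIsPullback (t.a m) (t.a m')))
    · change (pullbackLift s ≫ (Scheme.ProEt.forget X).map (pullbackProj m m' t)) ≫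
          (Scheme.ProEt.forget X).map ((etaleToProet X).map (pullback.fst (t.a m) (t.a m'))) =
        leg s t ≫ (Scheme.ProEt.forget X).map ((etaleToProet X).map (pullback.fst (t.a m) (t.a m')))
      rw [Category.assoc, ← Functor.map_comp, pullbackProj_fst, Functor.map_comp,
        pullbackLift_fst_assoc, liftFst_proj]
    · change (pullbackLift s ≫ (Scheme.ProEt.forget X).map (pullbackProj m m' t)) ≫
          (Scheme.ProEt.forget X).map ((etaleToProet X).map (pullback.snd (t.a m) (t.a m'))) =
        leg s t ≫ (Scheme.ProEt.forget X).map ((etaleToProet X).map (pullback.snd (t.a m) (t.a m')))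
      rw [Category.assoc, ← Functor.map_comp, pullbackProj_snd, Functor.map_comp,
        pullbackLift_snd_assoc, liftSnd_proj]
  uniq s g hg := by
    change s.pt ⟶ (Scheme.ProEt.forget X).obj (pullback (f m) (f m')) at g
    change g = pullbackLift s
    have hgt : ∀ t, g ≫ (Scheme.ProEt.forget X).map (pullbackProj m m' t) = leg s t := hg
    apply PullbackCone.IsLimit.hom_ext
      (isLimitPullbackConeMapOfIsLimit (Scheme.ProEt.forget X) _ (pullbackIsPullback (f m) (f m')))
    · change g ≫ (Scheme.ProEt.forget X).map (pullback.fst (f m) (f m')) =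
        pullbackLift s ≫ (Scheme.ProEt.forget X).map (pullback.fst (f m) (f m'))
      rw [pullbackLift_fst]
      refine (presentationV m).isLimit.uniq (coneFst s) _ fun t => ?_
      change (g ≫ (Scheme.ProEt.forget X).map (pullback.fst (f m) (f m'))) ≫
          (Scheme.ProEt.forget X).map ((𝔮 m).proj (t.k m)) =
        leg s t ≫ (Scheme.ProEt.forget X).map ((etaleToProet X).map (pullback.fst (t.a m) (t.a m')))
      rw [← hgt t, Category.assoc, Category.assoc, ← Functor.map_comp, ← Functor.map_comp,
        pullbackProj_fst]
    · change g ≫ (Scheme.ProEt.forget X).map (pullback.snd (f m) (f m')) =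
        pullbackLift s ≫ (Scheme.ProEt.forget X).map (pullback.snd (f m) (f m'))
      rw [pullbackLift_snd]
      refine (presentationV m').isLimit.uniq (coneSnd s) _ fun t => ?_
      change (g ≫ (Scheme.ProEt.forget X).map (pullback.snd (f m) (f m'))) ≫
          (Scheme.ProEt.forget X).map ((𝔮 m').proj (t.k m')) =
        leg s t ≫ (Scheme.ProEt.forget X).map ((etaleToProet X).map (pullback.snd (t.a m) (t.a m')))
      rw [← hgt t, Category.assoc, Category.assoc, ← Functor.map_comp, ← Functor.map_comp,
        pullbackProj_snd]

/-- The levelwise fibre products are affine. [folklore] -/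
instance isAffine_pullbackDiagram_obj_left (t : LevelIndex 𝔭 𝔮 f) :
    IsAffine ((pullbackDiagram m m').obj t).left := by
  haveI : IsAffine ((Scheme.Etale.forget X ⋙ Over.forget X).obj ((𝔮 m).diagram.obj (t.k m))) :=
    (𝔮 m).isAffine _
  haveI : IsAffine ((Scheme.Etale.forget X ⋙ Over.forget X).obj ((𝔮 m').diagram.obj (t.k m'))) :=
    (𝔮 m').isAffine _
  haveI : IsAffine ((Scheme.Etale.forget X ⋙ Over.forget X).obj (𝔭.diagram.obj t.i)) :=
    𝔭.isAffine _
  exact IsAffine.of_isIso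
    (PreservesPullback.iso (Scheme.Etale.forget X ⋙ Over.forget X) (t.a m) (t.a m')).hom

/-- **Bhatt–Scholze Remark 4.2.3 — the fibre product of pro-étale affines is a pro-étale affine**,
presented over the category of levels by the fibre products of the level maps.
[cite: BhattScholze2015, Remark 4.2.3] -/
@[reducible]
def presentationPullback : ProetAffinePresentation X (pullback (f m) (f m')) where
  ι := LevelIndex 𝔭 𝔮 f
  diagram := pullbackDiagram m m'
  isAffine t := isAffine_pullbackDiagram_obj_left m m' t
  π := pullbackCone m m'
  isLimit := isLimitPullbackCone m m'

end Pullback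

end LevelIndex

end LevelIndex

/-! ### `X_proét^aff` is closed under fibre products -/

namespace ProetAffinePresentation

/-- Transport of a presentation along an isomorphism. [folklore] -/
def ofIso {W W' : X.ProEt} (𝔭 : ProetAffinePresentation X W) (e : W ≅ W') :
    ProetAffinePresentation X W' where
  ι := 𝔭.ι
  diagram := 𝔭.diagram
  isAffine := 𝔭.isAffine
  π := { app := fun i => e.inv ≫ 𝔭.π.app i
         naturality := fun _ _ a => (Category.id_comp _).trans
           ((Category.assoc _ _ _).trans (congrArg (e.inv ≫ ·) (𝔭.π_comp a))).symm }
  isLimit := IsLimit.ofIsoLimit 𝔭.isLimit (Limits.Cone.ext ((Scheme.ProEt.forget X).mapIso e)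
    (fun i => by
      change (Scheme.ProEt.forget X).map _ =
        (Scheme.ProEt.forget X).map e.hom ≫ (Scheme.ProEt.forget X).map (e.inv ≫ _)
      rw [← Functor.map_comp, Iso.hom_inv_id_assoc]))

end ProetAffinePresentation

variable (X)

/-- Pro-étale affines are closed under isomorphisms. [cite: BhattScholze2015, Def. 4.2.1] -/
instance isClosedUnderIsomorphisms_isProetAffine : (isProetAffine X).IsClosedUnderIsomorphisms :=
  ⟨fun e ⟨𝔭⟩ => ⟨𝔭.ofIso e⟩⟩

/-- **Bhatt–Scholze Remark 4.2.3: pro-étale affines are closed under fibre products in `X_proét`.**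
[cite: BhattScholze2015, Remark 4.2.3] -/
instance isClosedUnderLimitsOfShape_isProetAffine :
    (isProetAffine X).IsClosedUnderLimitsOfShape WalkingCospan := by
  refine ⟨fun Y hY' => ?_⟩
  obtain ⟨hY⟩ := hY'
  let F := hY.diag
  obtain ⟨𝔭⟩ := hY.prop_diag_obj WalkingCospan.one
  have hV : ∀ j : WalkingPair, Nonempty (ProetAffinePresentation X (F.obj (some j))) := fun j =>
    hY.prop_diag_obj (some j)
  let 𝔮 : ∀ j : WalkingPair, ProetAffinePresentation X (F.obj (some j)) := fun j => (hV j).some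
  let f : ∀ j : WalkingPair, F.obj (some j) ⟶ F.obj WalkingCospan.one := fun j =>
    F.map (WidePullbackShape.Hom.term j)
  let 𝔯 : ProetAffinePresentation X (pullback (f WalkingPair.left) (f WalkingPair.right)) :=
    LevelIndex.presentationPullback (𝔭 := 𝔭) (𝔮 := 𝔮) (f := f) WalkingPair.left WalkingPair.right
  let e : Y ≅ pullback (f WalkingPair.left) (f WalkingPair.right) :=
    hY.isLimit.conePointUniqueUpToIso (limit.isLimit F) ≪≫ HasLimit.isoOfNatIso (diagramIsoCospan F)
  exact ⟨𝔯.ofIso e.symm⟩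

/-- `X_proét^aff` has fibre products. [cite: BhattScholze2015, Remark 4.2.3] -/
instance hasPullbacks_proetAffine : HasPullbacks (ProetAffine X) :=
  hasLimitsOfShape_of_closedUnderLimits _ _

/-- The inclusion `X_proét^aff ⥤ X_proét` preserves fibre products ("these agree with those in
`Sch/X`"). [cite: BhattScholze2015, Remark 4.2.3] -/
instance preservesLimitsOfShape_walkingCospan_proetAffineInclusion :
    PreservesLimitsOfShape WalkingCospan (proetAffineInclusion X) :=
  inferInstance

/-! ### Elements of `(Lan G)(W)` through a presentation -/

namespace ProetAffinePresentation

variable {X} {W : X.ProEt} (𝔭 : ProetAffinePresentation X W) (G : (X.Etale)ᵒᵖ ⥤ Ab.{u + 1})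

/-- Filtered colimits of size `u` in `Ab.{u+1}` are computed on underlying sets (Mathlib's instance
is stated for size `u+1`; used as a local instance only). [folklore] -/
theorem preservesFilteredColimitsOfSize_forget_ab :
    PreservesFilteredColimitsOfSize.{u, u} (forget Ab.{u + 1}) :=
  preservesFilteredColimitsOfSize_shrink.{u, u + 1, u, u + 1} _

attribute [local instance] preservesFilteredColimitsOfSize_forget_ab

/-- The leg `G(U_i) → (Lan G)(W)` of the colimit cocone of Step A (`lanCocone`), cleanly typed.
[cite: BhattScholze2015, Lemma 5.1.1 (proof)] -/
def lanLeg (i : 𝔭.ι) : G.obj (op (𝔭.diagram.obj i)) ⟶ ((etaleToProet X).op.lan.obj G).obj (op W) :=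
  (𝔭.lanCocone G).ι.app (op i)

/-- The leg at `i` is the Kan-extension unit at `U_i` followed by restriction along `π_i`. [folklore] -/
theorem lanLeg_eq (i : 𝔭.ι) : 𝔭.lanLeg G i =
    ((etaleToProet X).op.lanUnit.app G).app (op (𝔭.diagram.obj i)) ≫
      ((etaleToProet X).op.lan.obj G).map (𝔭.proj i).op :=
  𝔭.lanCocone_ι_app G (op i)

/-- The legs are compatible with the transition maps. [folklore] -/
@[reassoc]
theorem map_lanLeg {i j : 𝔭.ι} (a : i ⟶ j) :
    G.map (𝔭.diagram.map a).op ≫ 𝔭.lanLeg G i = 𝔭.lanLeg G j :=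
  (𝔭.lanCocone G).w a.op

/-- **Key computation: restriction along a map of pro-étale affines in terms of level
representatives.** If `b : Z_l → U_k` is a level representative of `h : Z → W`
(`(Z → Z_l → U_k) = (Z → W → U_k)`), then restricting the class of `y ∈ G(U_k)` along `h` gives the
class of `G(b)(y) ∈ G(Z_l)` (naturality of the Kan-extension unit). [cite: BhattScholze2015, Lemma 5.1.1 (proof)] -/
@[reassoc]
theorem lanLeg_map {Z : X.ProEt} (𝔯 : ProetAffinePresentation X Z) (h : Z ⟶ W) {l : 𝔯.ι} {k : 𝔭.ι}
    (b : 𝔯.diagram.obj l ⟶ 𝔭.diagram.obj k)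
    (hb : 𝔯.proj l ≫ (etaleToProet X).map b = h ≫ 𝔭.proj k) :
    𝔭.lanLeg G k ≫ ((etaleToProet X).op.lan.obj G).map h.op = G.map b.op ≫ 𝔯.lanLeg G l := by
  have hn := ((etaleToProet X).op.lanUnit.app G).naturality b.op
  rw [lanLeg_eq, lanLeg_eq, Category.assoc, ← Functor.map_comp, ← op_comp, ← hb, op_comp,
    Functor.map_comp, ← Category.assoc, ← Category.assoc]
  exact congrArg (· ≫ ((etaleToProet X).op.lan.obj G).map (𝔯.proj l).op) hn.symm

/-- Every element of `(Lan G)(W)` is the class of an element of some `G(U_i)`. [folklore] -/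
theorem exists_lanLeg_eq (x : ((etaleToProet X).op.lan.obj G).obj (op W)) :
    ∃ (i : 𝔭.ι) (y : G.obj (op (𝔭.diagram.obj i))), 𝔭.lanLeg G i y = x := by
  obtain ⟨i, y, h⟩ := Concrete.isColimit_exists_rep (𝔭.diagram.op ⋙ G) (𝔭.isColimitLanCocone G) x
  exact ⟨i.unop, y, h⟩

/-- Two classes agree iff the representatives agree at some deeper level. [folklore] -/
theorem lanLeg_eq_iff {i i' : 𝔭.ι} (y : G.obj (op (𝔭.diagram.obj i)))
    (y' : G.obj (op (𝔭.diagram.obj i'))) :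
    𝔭.lanLeg G i y = 𝔭.lanLeg G i' y' ↔ ∃ (j : 𝔭.ι) (a : j ⟶ i) (a' : j ⟶ i'),
      G.map (𝔭.diagram.map a).op y = G.map (𝔭.diagram.map a').op y' := by
  constructor
  · intro h
    obtain ⟨j, a, a', hj⟩ := (Concrete.isColimit_rep_eq_iff_exists (𝔭.diagram.op ⋙ G)
      (𝔭.isColimitLanCocone G) y y').1 h
    exact ⟨j.unop, a.unop, a'.unop, hj⟩
  · rintro ⟨j, a, a', hj⟩
    exact (Concrete.isColimit_rep_eq_iff_exists (𝔭.diagram.op ⋙ G)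
      (𝔭.isColimitLanCocone G) y y').2 ⟨op j, a.op, a'.op, hj⟩

/-- The class of a representative does not change under restriction to a deeper level. [folklore] -/
theorem lanLeg_apply_map {i j : 𝔭.ι} (a : i ⟶ j) (y : G.obj (op (𝔭.diagram.obj j))) :
    𝔭.lanLeg G i (G.map (𝔭.diagram.map a).op y) = 𝔭.lanLeg G j y := by
  rw [← 𝔭.map_lanLeg G a]
  rfl

/-- Restriction of a class along a map of pro-étale affines, on elements. [folklore] -/
theorem map_lanLeg_apply {Z : X.ProEt} (𝔯 : ProetAffinePresentation X Z) (h : Z ⟶ W) {l : 𝔯.ι}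
    {k : 𝔭.ι} (b : 𝔯.diagram.obj l ⟶ 𝔭.diagram.obj k)
    (hb : 𝔯.proj l ≫ (etaleToProet X).map b = h ≫ 𝔭.proj k) (y : G.obj (op (𝔭.diagram.obj k))) :
    ((etaleToProet X).op.lan.obj G).map h.op (𝔭.lanLeg G k y) = 𝔯.lanLeg G l (G.map b.op y) := by
  have := 𝔭.lanLeg_map G 𝔯 h b hb
  rw [← CategoryTheory.comp_apply, this]
  rfl

end ProetAffinePresentation

/-! ### The open image of a family of étale maps, and étale gluing on it -/

section ImageOpen

variable {X} {U : X.Etale} {M : Type} {V' : M → X.Etale} (a : ∀ m, V' m ⟶ U)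

/-- The union of the (open) images of a family of étale `X`-morphisms `a_m : V'_m → U`. [folklore] -/
def imageOpens : U.left.Opens :=
  ⨆ m, ⟨Set.range (a m).left.base, (a m).left.isOpenMap.isOpen_range⟩

/-- Membership in the union of images. [folklore] -/
theorem mem_imageOpens_iff (x : U.left) : x ∈ imageOpens a ↔ ∃ m v, (a m).left.base v = x := by
  simp only [imageOpens, TopologicalSpace.Opens.mem_iSup, TopologicalSpace.Opens.mem_mk,
    Set.mem_range]

/-- The open image `O = ⋃_m im(a_m) ⊆ U` as an object of `X_ét` (an open subscheme of an étale
`X`-scheme). [folklore] -/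
def imageObj : X.Etale :=
  MorphismProperty.Over.mk ⊤ ((imageOpens a).ι ≫ U.hom) inferInstance

/-- The inclusion `O → U` in `X_ét`. [folklore] -/
def imageι : imageObj a ⟶ U :=
  MorphismProperty.Over.homMk (imageOpens a).ι rfl

/-- The factorization `a_m : V'_m → O` on underlying schemes. [folklore] -/
def imageLiftLeft (m : M) : (V' m).left ⟶ (imageOpens a : Scheme.{u}) :=
  IsOpenImmersion.lift (imageOpens a).ι (a m).left (by
    rw [Scheme.Opens.range_ι]
    rintro _ ⟨v, rfl⟩
    exact (mem_imageOpens_iff a _).2 ⟨m, v, rfl⟩)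

/-- `(V'_m → O → U) = a_m` on underlying schemes. [folklore] -/
@[reassoc (attr := simp)]
theorem imageLiftLeft_ι (m : M) : imageLiftLeft a m ≫ (imageOpens a).ι = (a m).left :=
  IsOpenImmersion.lift_fac _ _ _

/-- The factorization `a_m : V'_m → O`. [folklore] -/
def imageLift (m : M) : V' m ⟶ imageObj a :=
  MorphismProperty.Over.homMk (imageLiftLeft a m) (by
    change imageLiftLeft a m ≫ (imageOpens a).ι ≫ U.hom = (V' m).hom
    rw [imageLiftLeft_ι_assoc]
    exact Over.w (a m).toCommaMorphism)

/-- `(V'_m → O → U) = a_m`. [folklore] -/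
@[reassoc (attr := simp)]
theorem imageLift_ι (m : M) : imageLift a m ≫ imageι a = a m :=
  MorphismProperty.Over.Hom.ext (imageLiftLeft_ι a m)

/-- The `a_m : V'_m → O` are jointly surjective, i.e. an étale cover of `O`. [folklore] -/
theorem ofArrows_imageLift_mem :
    Sieve.ofArrows _ (imageLift a) ∈ X.smallEtaleTopology (imageObj a) := by
  rw [Scheme.ofArrows_mem_smallEtaleTopology_iff]
  refine Set.eq_univ_of_forall fun o => ?_
  have ho : (imageOpens a).ι.base o ∈ imageOpens a := by
    rw [← SetLike.mem_coe, ← Scheme.Opens.range_ι]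
    exact ⟨o, rfl⟩
  obtain ⟨m, v, hv⟩ := (mem_imageOpens_iff a _).1 ho
  refine Set.mem_iUnion.2 ⟨m, v, (imageOpens a).ι.isOpenEmbedding.injective ?_⟩
  refine Eq.trans ?_ hv
  change ((imageLiftLeft a m ≫ (imageOpens a).ι)).base v = (a m).left.base v
  rw [imageLiftLeft_ι]

/-- The comparison `V'_m ×_O V'_{m'} → V'_m ×_U V'_{m'}` (an isomorphism, as `O → U` is a
monomorphism; only the map is needed). [folklore] -/
def pullbackImageLiftComparison (m m' : M) :
    pullback (imageLift a m) (imageLift a m') ⟶ pullback (a m) (a m') :=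
  pullback.lift (pullback.fst _ _) (pullback.snd _ _) (by
    rw [← imageLift_ι a m, ← imageLift_ι a m', ← Category.assoc, pullback.condition,
      Category.assoc])

variable (F : Sheaf X.smallEtaleTopology Ab.{u + 1})

/-- An étale sheaf satisfies the sheaf condition, on underlying sets, for the cover `{V'_m → O}`.
[folklore] -/
theorem isSheafFor_imageLift :
    Presieve.IsSheafFor (F.obj ⋙ forget Ab.{u + 1}) (Presieve.ofArrows _ (imageLift a)) := by
  have h := (Presheaf.isSheaf_iff_isSheaf_forget _ F.obj (forget Ab.{u + 1})).1 F.property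
  rw [isSheaf_iff_isSheaf_of_type] at h
  rw [Presieve.isSheafFor_iff_generate]
  exact h _ (ofArrows_imageLift_mem a)

/-- **Étale gluing on the open image**: sections `x_m ∈ F(V'_m)` agreeing on the
`V'_m ×_U V'_{m'}` glue to a unique section of `F` over `O = ⋃ im(a_m)`. [folklore] -/
theorem existsUnique_glue (x : ∀ m, F.obj.obj (op (V' m)))
    (hx : ∀ m m', F.obj.map (pullback.fst (a m) (a m')).op (x m) =
      F.obj.map (pullback.snd (a m) (a m')).op (x m')) :
    ∃! y : F.obj.obj (op (imageObj a)), ∀ m, F.obj.map (imageLift a m).op y = x m := by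
  have h := (Presieve.isSheafFor_arrows_iff_pullbacks _ _).1 (isSheafFor_imageLift a F) x
    (fun m m' => ?_)
  · exact h
  · change F.obj.map (pullback.fst (imageLift a m) (imageLift a m')).op (x m) =
      F.obj.map (pullback.snd (imageLift a m) (imageLift a m')).op (x m')
    have h₁ : pullback.fst (imageLift a m) (imageLift a m') =
        pullbackImageLiftComparison a m m' ≫ pullback.fst (a m) (a m') :=
      (pullback.lift_fst _ _ _).symm
    have h₂ : pullback.snd (imageLift a m) (imageLift a m') =
        pullbackImageLiftComparison a m m' ≫ pullback.snd (a m) (a m') :=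
      (pullback.lift_snd _ _ _).symm
    rw [h₁, h₂, op_comp, op_comp, F.obj.map_comp, F.obj.map_comp, CategoryTheory.comp_apply,
      CategoryTheory.comp_apply, hx]

/-- **Étale separation on the open image**: two sections of `F` over `O` agreeing on every `V'_m`
are equal. [folklore] -/
theorem glue_unique (y y' : F.obj.obj (op (imageObj a)))
    (h : ∀ m, F.obj.map (imageLift a m).op y = F.obj.map (imageLift a m).op y') : y = y' := by
  haveI : Mono (imageι a) := (Scheme.Etale.forget X ⋙ Over.forget X).mono_of_mono_map
    (show Mono (imageOpens a).ι from inferInstance)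
  have hc : ∀ m m', pullback.fst (a m) (a m') ≫ imageLift a m =
      pullback.snd (a m) (a m') ≫ imageLift a m' := fun m m' => by
    rw [← cancel_mono (imageι a), Category.assoc, Category.assoc, imageLift_ι, imageLift_ι,
      pullback.condition]
  obtain ⟨z, -, hz⟩ := existsUnique_glue a F (fun m => F.obj.map (imageLift a m).op y')
    (fun m m' => by
      rw [← CategoryTheory.comp_apply, ← CategoryTheory.comp_apply, ← F.obj.map_comp,
        ← F.obj.map_comp, ← op_comp, ← op_comp, hc])
  exact (hz y h).trans (hz y' fun _ => rfl).symm

end ImageOpen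

/-! ### Factoring the projections of a presentation through an open of a level -/

namespace ProetAffinePresentation

variable {X} {W : X.ProEt} (𝔭 : ProetAffinePresentation X W)

/-- **Straightening through an open.** If the image of `π_i : W → U_i` lies in the open
`O = ⋃ im(a_m) ⊆ U_i`, then some transition map `U_j → U_i` factors through `O`: the lift
`W → O` factors through some `U_j` (Stacks 01ZC for the étale `X`-scheme `O`), and the two resulting
maps `U_j → U_i` agree after refining `j`. [cite: StacksProject, Tag 01ZC] -/
theorem exists_map_factor_imageι {i : 𝔭.ι} {M : Type} {V' : M → X.Etale}
    (a : ∀ m, V' m ⟶ 𝔭.diagram.obj i)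
    (h : Set.range (𝔭.proj i).left.base ⊆ (imageOpens a : Set (𝔭.diagram.obj i).left)) :
    ∃ (j : 𝔭.ι) (σ : j ⟶ i) (g : 𝔭.diagram.obj j ⟶ imageObj a),
      g ≫ imageι a = 𝔭.diagram.map σ := by
  let l₀ : W.left ⟶ (imageOpens a : Scheme.{u}) :=
    IsOpenImmersion.lift (imageOpens a).ι (𝔭.proj i).left (by rwa [Scheme.Opens.range_ι])
  have hl₀ : l₀ ≫ (imageOpens a).ι = (𝔭.proj i).left := IsOpenImmersion.lift_fac _ _ _
  let l : W ⟶ (etaleToProet X).obj (imageObj a) :=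
    MorphismProperty.Over.homMk l₀ (by
      change l₀ ≫ (imageOpens a).ι ≫ (𝔭.diagram.obj i).hom = W.hom
      rw [reassoc_of% hl₀]
      exact Over.w (𝔭.proj i).toCommaMorphism)
  have hl : l ≫ (etaleToProet X).map (imageι a) = 𝔭.proj i := MorphismProperty.Over.Hom.ext hl₀
  obtain ⟨j₀, g₀, hg₀⟩ := 𝔭.exists_proj_fac _ l
  let j₁ := IsCofiltered.min j₀ i
  have key : 𝔭.proj j₁ ≫ (etaleToProet X).map
      ((𝔭.diagram.map (IsCofiltered.minToLeft j₀ i) ≫ g₀) ≫ imageι a) =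
      𝔭.proj j₁ ≫ (etaleToProet X).map (𝔭.diagram.map (IsCofiltered.minToRight j₀ i)) := by
    rw [Functor.map_comp, Functor.map_comp, Category.assoc, 𝔭.proj_comp_assoc, reassoc_of% hg₀, hl,
      𝔭.proj_comp]
  obtain ⟨j, τ, hτ⟩ := 𝔭.exists_proj_comp_eq _ _ _ key
  refine ⟨j, τ ≫ IsCofiltered.minToRight j₀ i, 𝔭.diagram.map τ ≫
    𝔭.diagram.map (IsCofiltered.minToLeft j₀ i) ≫ g₀, ?_⟩
  simpa only [Category.assoc, Functor.map_comp] using hτ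

/-- The image of `π_i : W → U_i` lies in `⋃ im(a_m)` as soon as the `a_m` are level maps of a
jointly surjective family `f_m : V_m → W`. [folklore] -/
theorem range_proj_subset_imageOpens {i : 𝔭.ι} {M : Type} {V : M → X.ProEt}
    (𝔮 : ∀ m, ProetAffinePresentation X (V m)) (f : ∀ m, V m ⟶ W)
    (hf : ∀ w : W.left, ∃ m v, (f m).left.base v = w)
    (k : ∀ m, (𝔮 m).ι) (a : ∀ m, (𝔮 m).diagram.obj (k m) ⟶ 𝔭.diagram.obj i)
    (w : ∀ m, (𝔮 m).proj (k m) ≫ (etaleToProet X).map (a m) = f m ≫ 𝔭.proj i) :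
    Set.range (𝔭.proj i).left.base ⊆ (imageOpens a : Set (𝔭.diagram.obj i).left) := by
  rintro _ ⟨x, rfl⟩
  obtain ⟨m, v, rfl⟩ := hf x
  refine (mem_imageOpens_iff a _).2 ⟨m, ((𝔮 m).proj (k m)).left.base v, ?_⟩
  exact congrArg (fun g : V m ⟶ (etaleToProet X).obj (𝔭.diagram.obj i) => g.left.base v) (w m)

end ProetAffinePresentation

/-! ### Auxiliary: single-morphism form of the colimit criterion; cones over finitely many maps -/

/-- Composition of two restriction maps of a presheaf on `X_ét`, on elements. [folklore] -/
theorem map_map_apply {X : Scheme.{u}} (G : (X.Etale)ᵒᵖ ⥤ Ab.{u + 1}) {A B C : X.Etale}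
    (a : A ⟶ B) (b : B ⟶ C)
    (z : G.obj (op C)) : G.map a.op (G.map b.op z) = G.map (a ≫ b).op z := by
  rw [op_comp, G.map_comp, CategoryTheory.comp_apply]

namespace ProetAffinePresentation

variable {X} {W : X.ProEt} (𝔭 : ProetAffinePresentation X W) (G : (X.Etale)ᵒᵖ ⥤ Ab.{u + 1})

/-- Two classes at the same level agree iff the representatives agree after one common transition
map. [folklore] -/
theorem lanLeg_eq_iff' {i : 𝔭.ι} (y y' : G.obj (op (𝔭.diagram.obj i))) :
    𝔭.lanLeg G i y = 𝔭.lanLeg G i y' ↔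
      ∃ (j : 𝔭.ι) (a : j ⟶ i), G.map (𝔭.diagram.map a).op y = G.map (𝔭.diagram.map a).op y' := by
  rw [lanLeg_eq_iff]
  constructor
  · rintro ⟨j, a, a', h⟩
    refine ⟨IsCofiltered.eq a a', IsCofiltered.eqHom a a' ≫ a, ?_⟩
    conv_rhs => rw [IsCofiltered.eq_condition a a']
    rw [Functor.map_comp, Functor.map_comp, op_comp, op_comp, G.map_comp, G.map_comp,
      CategoryTheory.comp_apply, CategoryTheory.comp_apply, h]
  · rintro ⟨j, a, h⟩
    exact ⟨j, a, a, h⟩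

end ProetAffinePresentation

/-- In a cofiltered category, finitely many maps into one object are dominated by a single map.
[folklore] -/
theorem exists_hom_comp_eq_of_finite {T : Type u} [SmallCategory T] [IsCofiltered T] {N : Type}
    [Finite N] (r : T) (s : N → T) (δ : ∀ n, s n ⟶ r) :
    ∃ (S : T) (θ : S ⟶ r) (η : ∀ n, S ⟶ s n), ∀ n, η n ≫ δ n = θ := by
  classical
  let _ := Fintype.ofFinite N
  let c := IsCofiltered.cone (WidePullbackShape.wideCospan r s δ)
  refine ⟨c.pt, c.π.app none, fun n => c.π.app (some n), fun n => ?_⟩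
  have h := c.w (WidePullbackShape.Hom.term n)
  simpa using h

namespace LevelIndex

variable {X} {W : X.ProEt} {𝔭 : ProetAffinePresentation X W} {M : Type} {V : M → X.ProEt}
  {𝔮 : ∀ m, ProetAffinePresentation X (V m)} {f : ∀ m, V m ⟶ W}

/-- A refinement of the `W`-level lifts to a morphism of levels. [cite: BhattScholze2015, Lemma 4.2.2] -/
theorem exists_hom_hi_eq (t : LevelIndex 𝔭 𝔮 f) {j : 𝔭.ι} (σ : j ⟶ t.i) :
    ∃ (k : ∀ m, (𝔮 m).ι) (a : ∀ m, (𝔮 m).diagram.obj (k m) ⟶ 𝔭.diagram.obj j)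
      (w : ∀ m, (𝔮 m).proj (k m) ≫ (etaleToProet X).map (a m) = f m ≫ 𝔭.proj j)
      (ψ : (⟨j, k, a, w⟩ : LevelIndex 𝔭 𝔮 f) ⟶ t), ψ.hi = σ := by
  have key : ∀ m, ∃ (k : (𝔮 m).ι) (a : (𝔮 m).diagram.obj k ⟶ 𝔭.diagram.obj j)
      (e : k ⟶ t.k m), (𝔮 m).proj k ≫ (etaleToProet X).map a = f m ≫ 𝔭.proj j ∧
      a ≫ 𝔭.diagram.map σ = (𝔮 m).diagram.map e ≫ t.a m := by
    intro m
    obtain ⟨k₀, a₀, w₀⟩ := exists_level (𝔭 := 𝔭) (𝔮 := 𝔮) (f := f) m j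
    obtain ⟨k₁, e, e₁, h₁⟩ := exists_level_over m σ a₀ w₀ (t.a m) (t.w m)
    exact ⟨k₁, (𝔮 m).diagram.map e ≫ a₀, e₁, level_w_of_comp m j e a₀ w₀, h₁⟩
  choose k a e w h using key
  exact ⟨k, a, w, ⟨σ, e, h⟩, rfl⟩

end LevelIndex

/-! ### The sheaf condition for `Lan F` on finite jointly surjective families of pro-étale affines -/

section Core

variable {X} {W : X.ProEt} (𝔭 : ProetAffinePresentation X W) {M : Type} [Finite M] {V : M → X.ProEt}
  (𝔮 : ∀ m, ProetAffinePresentation X (V m)) (f : ∀ m, V m ⟶ W)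
  (hf : ∀ w : W.left, ∃ m v, (f m).left.base v = w) (F : Sheaf X.smallEtaleTopology Ab.{u + 1})

include 𝔭 𝔮 hf in
open LevelIndex in
/-- **Separation**: a section of `Lan F` over a pro-étale affine `W` is determined by its
restrictions to a finite jointly surjective family of pro-étale affines `V_m → W`. Two classes
`[ũ], [ũ'] ∈ colim F(U_i)` with equal restrictions have representatives at a common level whose
pullbacks along the level maps `a_m : V_{m,k_m} → U_i` agree; these glue (étale separation of `F`)
on the open `O = ⋃ im(a_m)`, through which a deeper `U_j → U_i` factors since `im(W → U_i) ⊆ O`.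
[cite: BhattScholze2015, Lemma 5.1.1 (proof)] -/
theorem lan_ext (u u' : ((etaleToProet X).op.lan.obj F.obj).obj (op W))
    (h : ∀ m, ((etaleToProet X).op.lan.obj F.obj).map (f m).op u =
      ((etaleToProet X).op.lan.obj F.obj).map (f m).op u') : u = u' := by
  classical
  let T := LevelIndex 𝔭 𝔮 f
  let 𝔭T : ProetAffinePresentation X W := presentationW (𝔭 := 𝔭) (𝔮 := 𝔮) (f := f)
  let 𝔮T : ∀ m, ProetAffinePresentation X (V m) := fun m =>
    presentationV (𝔭 := 𝔭) (𝔮 := 𝔮) (f := f) m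
  -- representatives at a common level `r`
  obtain ⟨r₁, ũ₁, hũ₁⟩ := 𝔭T.exists_lanLeg_eq F.obj u
  obtain ⟨r₂, ũ₂, hũ₂⟩ := 𝔭T.exists_lanLeg_eq F.obj u'
  let r : T := IsCofiltered.min r₁ r₂
  let ũ : F.obj.obj (op (𝔭.diagram.obj r.i)) :=
    F.obj.map (𝔭.diagram.map (IsCofiltered.minToLeft r₁ r₂ : r ⟶ r₁).hi).op ũ₁
  let ũ' : F.obj.obj (op (𝔭.diagram.obj r.i)) :=
    F.obj.map (𝔭.diagram.map (IsCofiltered.minToRight r₁ r₂ : r ⟶ r₂).hi).op ũ₂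
  have hũ : 𝔭T.lanLeg F.obj r ũ = u := (𝔭T.lanLeg_apply_map F.obj _ ũ₁).trans hũ₁
  have hũ' : 𝔭T.lanLeg F.obj r ũ' = u' := (𝔭T.lanLeg_apply_map F.obj _ ũ₂).trans hũ₂
  -- the restrictions agree at some level below `r`, for each `m`
  have key : ∀ m, ∃ (s : T) (δ : s ⟶ r),
      F.obj.map ((𝔮 m).diagram.map (δ.hk m)).op (F.obj.map (r.a m).op ũ) =
        F.obj.map ((𝔮 m).diagram.map (δ.hk m)).op (F.obj.map (r.a m).op ũ') := by
    intro m
    have hm := h m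
    rw [← hũ, ← hũ', 𝔭T.map_lanLeg_apply F.obj (𝔮T m) (f m) (r.a m) (r.w m),
      𝔭T.map_lanLeg_apply F.obj (𝔮T m) (f m) (r.a m) (r.w m)] at hm
    exact ((𝔮T m).lanLeg_eq_iff' F.obj _ _).1 hm
  choose s δ hδ using key
  -- one level `S` below all of them, with a single structure map `θ : S ⟶ r`
  obtain ⟨S, θ, η, hη⟩ := exists_hom_comp_eq_of_finite r s δ
  have hS : ∀ m, F.obj.map (S.a m).op (F.obj.map (𝔭.diagram.map θ.hi).op ũ) =
      F.obj.map (S.a m).op (F.obj.map (𝔭.diagram.map θ.hi).op ũ') := by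
    intro m
    have e := congrArg (F.obj.map ((𝔮 m).diagram.map ((η m).hk m)).op) (hδ m)
    simp only [← CategoryTheory.comp_apply, ← Functor.map_comp, ← op_comp] at e
    rw [← Category.assoc, ← Functor.map_comp, ← comp_hk, hη, ← hom_w] at e
    simpa only [op_comp, Functor.map_comp, CategoryTheory.comp_apply] using e
  -- glue on the open image of the level maps at `S`
  have e1 : ∀ m (z : F.obj.obj (op (𝔭.diagram.obj S.i))),
      F.obj.map (imageLift S.a m).op (F.obj.map (imageι S.a).op z) = F.obj.map (S.a m).op z :=
    fun m z => by
      rw [← CategoryTheory.comp_apply, ← F.obj.map_comp, ← op_comp, imageLift_ι]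
  have hO := glue_unique S.a F (F.obj.map (imageι S.a).op (F.obj.map (𝔭.diagram.map θ.hi).op ũ))
    (F.obj.map (imageι S.a).op (F.obj.map (𝔭.diagram.map θ.hi).op ũ')) (fun m => by
      rw [e1, e1]
      exact hS m)
  -- straighten: a deeper transition map of `W` factors through the open
  obtain ⟨j, σ, g, hg⟩ := 𝔭.exists_map_factor_imageι S.a
    (𝔭.range_proj_subset_imageOpens 𝔮 f hf S.k S.a S.w)
  obtain ⟨k', a', w', ψ, hψ⟩ := S.exists_hom_hi_eq σ
  -- conclude at the level `S' = ⟨j, k', a', w'⟩`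
  have eS : 𝔭T.lanLeg F.obj S (F.obj.map (𝔭.diagram.map θ.hi).op ũ) =
      𝔭T.lanLeg F.obj S (F.obj.map (𝔭.diagram.map θ.hi).op ũ') := by
    rw [← 𝔭T.lanLeg_apply_map F.obj ψ, ← 𝔭T.lanLeg_apply_map F.obj ψ]
    change 𝔭T.lanLeg F.obj ⟨j, k', a', w'⟩ (F.obj.map (𝔭.diagram.map ψ.hi).op _) =
      𝔭T.lanLeg F.obj ⟨j, k', a', w'⟩ (F.obj.map (𝔭.diagram.map ψ.hi).op _)
    rw [hψ, ← hg, op_comp, F.obj.map_comp, CategoryTheory.comp_apply,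
      CategoryTheory.comp_apply, hO]
  rw [← hũ, ← hũ', ← 𝔭T.lanLeg_apply_map F.obj θ, ← 𝔭T.lanLeg_apply_map F.obj θ]
  exact eS

include 𝔭 𝔮 hf in
open LevelIndex in
/-- **Gluing**: sections `x_m` of `Lan F` over a finite jointly surjective family of pro-étale
affines `V_m → W` which agree on the fibre products `V_m ×_W V_{m'}` come from a section over `W`.
Representatives `x̃_m ∈ F(V_{m,k_m})` at a common level satisfy, by the levelwise presentation of
`V_m ×_W V_{m'}` (Remark 4.2.3), the étale descent condition on the
`V_{m,k_m} ×_{U_i} V_{m',k_{m'}}` at some deeper level; they glue (`F` is an étale sheaf) to a section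
over the open `O = ⋃ im(a_m) ⊆ U_i`, which restricts to some `U_j` factoring through `O`
(`im(W → U_i) ⊆ O`, Stacks 01ZC); its class is the sought section.
[cite: BhattScholze2015, Lemma 5.1.1 (proof)] -/
theorem lan_exists_amalgamation (x : ∀ m, ((etaleToProet X).op.lan.obj F.obj).obj (op (V m)))
    (hx : ∀ m m', ((etaleToProet X).op.lan.obj F.obj).map (pullback.fst (f m) (f m')).op (x m) =
      ((etaleToProet X).op.lan.obj F.obj).map (pullback.snd (f m) (f m')).op (x m')) :
    ∃ t : ((etaleToProet X).op.lan.obj F.obj).obj (op W),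
      ∀ m, ((etaleToProet X).op.lan.obj F.obj).map (f m).op t = x m := by
  classical
  let T := LevelIndex 𝔭 𝔮 f
  let 𝔭T : ProetAffinePresentation X W := presentationW (𝔭 := 𝔭) (𝔮 := 𝔮) (f := f)
  let 𝔮T : ∀ m, ProetAffinePresentation X (V m) := fun m =>
    presentationV (𝔭 := 𝔭) (𝔮 := 𝔮) (f := f) m
  let 𝔯 : ∀ m m', ProetAffinePresentation X (pullback (f m) (f m')) := fun m m' =>
    presentationPullback (𝔭 := 𝔭) (𝔮 := 𝔮) (f := f) m m'
  -- representatives at a common level `t₀`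
  have hrep : ∀ m, ∃ (r : T) (y : F.obj.obj (op ((𝔮 m).diagram.obj (r.k m)))),
      (𝔮T m).lanLeg F.obj r y = x m := fun m => (𝔮T m).exists_lanLeg_eq F.obj (x m)
  choose r y hy using hrep
  let _ := Fintype.ofFinite M
  obtain ⟨t₀, ht₀⟩ := IsCofiltered.inf_objs_exists (Finset.univ.image r)
  have ρ : ∀ m, t₀ ⟶ r m := fun m => (ht₀ (Finset.mem_image_of_mem r (Finset.mem_univ m))).some
  obtain ⟨x₀, hx₀⟩ : ∃ x₀ : ∀ m, F.obj.obj (op ((𝔮 m).diagram.obj (t₀.k m))),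
      ∀ m, (𝔮T m).lanLeg F.obj t₀ (x₀ m) = x m :=
    ⟨fun m => F.obj.map ((𝔮 m).diagram.map ((ρ m).hk m)).op (y m), fun m =>
      ((𝔮T m).lanLeg_apply_map F.obj (ρ m) (y m)).trans (hy m)⟩
  -- the descent condition holds at some level below `t₀`, for each pair
  have key : ∀ mm' : M × M, ∃ (s : T) (δ : s ⟶ t₀),
      F.obj.map ((pullbackDiagram mm'.1 mm'.2).map δ).op
          (F.obj.map (pullback.fst (t₀.a mm'.1) (t₀.a mm'.2)).op (x₀ mm'.1)) =
        F.obj.map ((pullbackDiagram mm'.1 mm'.2).map δ).op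
          (F.obj.map (pullback.snd (t₀.a mm'.1) (t₀.a mm'.2)).op (x₀ mm'.2)) := by
    rintro ⟨m, m'⟩
    have hm := hx m m'
    rw [← hx₀ m, ← hx₀ m',
      (𝔮T m).map_lanLeg_apply F.obj (𝔯 m m') (pullback.fst (f m) (f m'))
        (pullback.fst (t₀.a m) (t₀.a m')) (pullbackProj_fst m m' t₀),
      (𝔮T m').map_lanLeg_apply F.obj (𝔯 m m') (pullback.snd (f m) (f m'))
        (pullback.snd (t₀.a m) (t₀.a m')) (pullbackProj_snd m m' t₀)] at hm
    exact ((𝔯 m m').lanLeg_eq_iff' F.obj _ _).1 hm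
  choose s δ hδ using key
  -- one level `S` below all of them, with a single structure map `θ : S ⟶ t₀`
  obtain ⟨S, θ, η, hη⟩ := exists_hom_comp_eq_of_finite t₀ s δ
  obtain ⟨x₁, hx₁', hx₁⟩ : ∃ x₁ : ∀ m, F.obj.obj (op ((𝔮 m).diagram.obj (S.k m))),
      (∀ m, x₁ m = F.obj.map ((𝔮 m).diagram.map (θ.hk m)).op (x₀ m)) ∧
      ∀ m, (𝔮T m).lanLeg F.obj S (x₁ m) = x m :=
    ⟨fun m => F.obj.map ((𝔮 m).diagram.map (θ.hk m)).op (x₀ m), fun _ => rfl, fun m =>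
      ((𝔮T m).lanLeg_apply_map F.obj θ (x₀ m)).trans (hx₀ m)⟩
  have hS : ∀ m m', F.obj.map (pullback.fst (S.a m) (S.a m')).op (x₁ m) =
      F.obj.map (pullback.snd (S.a m) (S.a m')).op (x₁ m') := by
    intro m m'
    have e₀ := hδ (m, m')
    rw [map_map_apply, map_map_apply, pullbackDiagram_map_fst, pullbackDiagram_map_snd] at e₀
    have e := congrArg (F.obj.map ((pullbackDiagram m m').map (η (m, m'))).op) e₀
    rw [map_map_apply, map_map_apply, ← Category.assoc, ← Category.assoc, pullbackDiagram_map_fst,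
      pullbackDiagram_map_snd, Category.assoc, Category.assoc, ← Functor.map_comp,
      ← Functor.map_comp, ← comp_hk, ← comp_hk, hη, ← map_map_apply, ← map_map_apply, ← hx₁',
      ← hx₁'] at e
    exact e
  -- glue on the open image of the level maps at `S`
  obtain ⟨yO, hyO, -⟩ := existsUnique_glue S.a F x₁ hS
  -- straighten: a deeper transition map of `W` factors through the open
  obtain ⟨j, σ, g, hg⟩ := 𝔭.exists_map_factor_imageι S.a
    (𝔭.range_proj_subset_imageOpens 𝔮 f hf S.k S.a S.w)
  obtain ⟨k', a', w', ψ, hψ⟩ := S.exists_hom_hi_eq σ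
  haveI : Mono (imageι S.a) := (Scheme.Etale.forget X ⋙ Over.forget X).mono_of_mono_map
    (show Mono (imageOpens S.a).ι from inferInstance)
  -- the amalgamation: the class of `yO` restricted to `U_j`
  refine ⟨𝔭T.lanLeg F.obj ⟨j, k', a', w'⟩ (F.obj.map g.op yO), fun m => ?_⟩
  rw [𝔭T.map_lanLeg_apply F.obj (𝔮T m) (f m) (l := ⟨j, k', a', w'⟩) (k := ⟨j, k', a', w'⟩)
      (a' m) (w' m), ← hx₁ m,
    ← (𝔮T m).lanLeg_apply_map F.obj ψ (x₁ m), ← hyO m]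
  change (𝔮T m).lanLeg F.obj ⟨j, k', a', w'⟩ (F.obj.map (a' m).op (F.obj.map g.op yO)) =
    (𝔮T m).lanLeg F.obj ⟨j, k', a', w'⟩
      (F.obj.map ((𝔮 m).diagram.map (ψ.hk m)).op (F.obj.map (imageLift S.a m).op yO))
  have hc : a' m ≫ g = (𝔮 m).diagram.map (ψ.hk m) ≫ imageLift S.a m := by
    rw [← cancel_mono (imageι S.a), Category.assoc, Category.assoc, hg, imageLift_ι, ← hψ]
    exact hom_w ψ m
  rw [map_map_apply, map_map_apply, hc]

end Core

/-! ### The sheaf condition on `X_proét^aff` for finite jointly surjective families -/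

section Subcategory

/-- A finite family of pro-étale affines over a pro-étale affine is **jointly surjective** if every
point of the base is in the image of some member. [folklore] -/
def JointlySurjective {c : ProetAffine X} {M : Type} (e : M → ProetAffine X) (p : ∀ m, e m ⟶ c) :
    Prop :=
  ∀ w : c.obj.left, ∃ (m : M) (v : (e m).obj.left),
    ((proetAffineInclusion X).map (p m)).left.base v = w

variable {X}

/-- **`Lan F` satisfies the sheaf condition for every finite jointly surjective family of
pro-étale affines** (as a presheaf of sets on `X_proét^aff`): gluing by
`lan_exists_amalgamation`, uniqueness by `lan_ext`, the fibre products `V_m ×_W V_{m'}` being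
pro-étale affines (Remark 4.2.3). [cite: BhattScholze2015, Lemma 5.1.1 (proof)] -/
theorem isSheafFor_lan_ofArrows (F : Sheaf X.smallEtaleTopology Ab.{u + 1}) {c : ProetAffine X}
    {M : Type} [Finite M] (e : M → ProetAffine X) (p : ∀ m, e m ⟶ c)
    (hp : JointlySurjective X e p) :
    Presieve.IsSheafFor (((proetAffineInclusion X).op ⋙ (etaleToProet X).op.lan.obj F.obj) ⋙
      forget Ab.{u + 1}) (Presieve.ofArrows e p) := by
  rw [Presieve.isSheafFor_arrows_iff]
  intro x hx
  let 𝔭 : ProetAffinePresentation X c.obj := c.property.some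
  let 𝔮 : ∀ m, ProetAffinePresentation X (e m).obj := fun m => (e m).property.some
  let f : ∀ m, (e m).obj ⟶ c.obj := fun m => (proetAffineInclusion X).map (p m)
  have hx' : ∀ m m', ((etaleToProet X).op.lan.obj F.obj).map (pullback.fst (f m) (f m')).op (x m) =
      ((etaleToProet X).op.lan.obj F.obj).map (pullback.snd (f m) (f m')).op (x m') := by
    intro m m'
    let Z : ProetAffine X := ⟨pullback (f m) (f m'),
      ⟨LevelIndex.presentationPullback (𝔭 := 𝔭) (𝔮 := 𝔮) (f := f) m m'⟩⟩
    exact hx m m' Z (ObjectProperty.homMk (pullback.fst (f m) (f m')))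
      (ObjectProperty.homMk (pullback.snd (f m) (f m'))) (ObjectProperty.hom_ext _ pullback.condition)
  obtain ⟨t, ht⟩ := lan_exists_amalgamation 𝔭 𝔮 f hp F x hx'
  exact ⟨t, ht, fun t' ht' => lan_ext 𝔭 𝔮 f hp F t' t fun m => (ht' m).trans (ht m).symm⟩

/-- Joint surjectivity is stable under base change along any map of pro-étale affines (points of
fibre products of schemes, Mathlib `Scheme.Pullback.exists_preimage_pullback`; the inclusion
`X_proét^aff ⥤ Sch` preserves fibre products). [folklore] -/
theorem JointlySurjective.pullback_snd {c c' : ProetAffine X} (g : c' ⟶ c) {M : Type}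
    {e : M → ProetAffine X} {p : ∀ m, e m ⟶ c} (hp : JointlySurjective X e p) :
    JointlySurjective X (fun m => pullback (p m) g) (fun m => pullback.snd (p m) g) := by
  intro w'
  obtain ⟨m, v, hv⟩ := hp (((proetAffineInclusion X).map g).left.base w')
  let G := proetAffineInclusion X ⋙ Scheme.ProEt.forget X ⋙ Over.forget X
  obtain ⟨z, -, hz⟩ := Scheme.Pullback.exists_preimage_pullback (f := G.map (p m)) (g := G.map g)
    v w' hv
  refine ⟨m, (PreservesPullback.iso G (p m) g).inv.base z, ?_⟩
  change ((PreservesPullback.iso G (p m) g).inv ≫ G.map (pullback.snd (p m) g)).base z = w'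
  rw [PreservesPullback.iso_inv_snd]
  exact hz

/-- A pro-étale affine is quasi-compact (a cofiltered limit of affine schemes with affine
transition maps; Mathlib `Scheme.compactSpace_of_isLimit`). [folklore] -/
theorem ProetAffinePresentation.compactSpace {W : X.ProEt} (𝔭 : ProetAffinePresentation X W) :
    CompactSpace W.left := by
  haveI : ∀ {i j : 𝔭.ι} (a : i ⟶ j),
      IsAffineHom (((𝔭.diagram ⋙ Scheme.Etale.forget X) ⋙ Over.forget X).map a) :=
    fun a => 𝔭.isAffineHom_forget_map_left a
  haveI : ∀ i : 𝔭.ι, CompactSpace (((𝔭.diagram ⋙ Scheme.Etale.forget X) ⋙ Over.forget X).obj i) :=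
    fun i => 𝔭.compactSpace_forget_obj_left i
  exact Scheme.compactSpace_of_isLimit ((𝔭.diagram ⋙ Scheme.Etale.forget X) ⋙ Over.forget X)
    ((Over.forget X).mapCone 𝔭.overCone) (isLimitOfPreserves (Over.forget X) 𝔭.isLimitOverCone)

/-- **A pro-étale covering sieve of a quasi-compact object contains a finite jointly surjective
family** (the pro-étale topology is generated by fpqc, in particular quasi-compact, covers by
weakly étale maps). [folklore] -/
theorem exists_finite_of_mem_proEtTopology (W : X.ProEt) [CompactSpace W.left] (S : Sieve W)
    (hS : S ∈ Scheme.ProEt.topology X W) :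
    ∃ (n : ℕ) (Y : Fin n → X.ProEt) (φ : ∀ m, Y m ⟶ W),
      (∀ m, S (φ m)) ∧ ∀ w : W.left, ∃ m v, (φ m).left.base v = w := by
  haveI : (Scheme.ProEt.precoverage X).IsStableUnderBaseChange := by
    unfold Scheme.ProEt.precoverage; infer_instance
  haveI : (Scheme.ProEt.precoverage X).IsStableUnderComposition := by
    unfold Scheme.ProEt.precoverage; infer_instance
  haveI : (Scheme.ProEt.precoverage X).HasIsos := by
    unfold Scheme.ProEt.precoverage; infer_instance
  obtain ⟨R, hR, hle⟩ := (Precoverage.mem_toGrothendieck_iff_of_isStableUnderComposition).1 hS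
  obtain ⟨I₀, Y, φ, rfl⟩ := R.exists_eq_ofArrows
  have hR' : Presieve.ofArrows (fun i => (Y i).left) (fun i => (φ i).left) ∈
      Scheme.proetalePrecoverage W.left := by
    have h := hR
    rw [Scheme.ProEt.precoverage, Precoverage.mem_comap_iff, Presieve.map_ofArrows] at h
    exact h
  let E : PreZeroHypercover.{u + 1} W.left := ⟨I₀, fun i => (Y i).left, fun i => (φ i).left⟩
  haveI : QuasiCompactCover E := Scheme.presieve₀_mem_qcPrecoverage_iff.1 hR'.1
  obtain ⟨n, g, V, -, hV⟩ := QuasiCompactCover.exists_isAffineOpen_of_isCompact E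
    (U := ⊤) isCompact_univ
  refine ⟨n, fun m => Y (g m), fun m => φ (g m), fun m => hle _ _ (Presieve.ofArrows.mk (g m)),
    fun w => ?_⟩
  have hw : w ∈ ⋃ i, (E.f (g i)).base '' (V i : Set (E.X (g i))) := by
    rw [hV]
    trivial
  obtain ⟨m, v, -, hv⟩ := Set.mem_iUnion.1 hw
  exact ⟨m, v, hv⟩

end Subcategory

/-! ### Bhatt–Scholze Lemma 5.1.1, second step: `Lan F` is a sheaf on `X_proét^aff` -/

/-- **`Lan F` is a sheaf on `X_proét^aff`, discharged** (`isSheaf_lan_comp_proetAffineInclusion`;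
Bhatt–Scholze Lemma 5.1.1, proof: "It thus suffices to check that `F'` is a sheaf"). We prove
the sheaf property for the *restricted* topology (Mathlib `Functor.restrictedTopology`: generated
by the families of pro-étale affines whose images generate a pro-étale covering sieve), which is
finer than the induced one (`Functor.inducedTopology_le_restrictedTopology`), so that neither
Lemma 4.2.4 nor Theorem 2.3.4 is needed: by `Presieve.isSheaf_toGrothendieck_iff` it suffices to
treat the pullbacks of generating families; a generating family of the affine (quasi-compact) `W`
contains a finite jointly surjective subfamily (`exists_finite_of_mem_proEtTopology`), whose base
change along any map of pro-étale affines is again a finite jointly surjective family of pro-étale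
affines (Remark 4.2.3, `hasPullbacks_proetAffine`), for which the sheaf condition is
`isSheafFor_lan_ofArrows` (`Presieve.isSheafFor_subsieve`).
[cite: BhattScholze2015, Lemma 5.1.1 (proof)] -/
theorem isSheaf_lan_comp_proetAffineInclusion_holds : isSheaf_lan_comp_proetAffineInclusion.{u} := by
  intro X F
  rw [Presheaf.isSheaf_iff_isSheaf_forget _ _ (forget Ab.{u + 1}), isSheaf_iff_isSheaf_of_type]
  refine Presieve.isSheaf_of_le _ Functor.inducedTopology_le_restrictedTopology ?_
  change Presieve.IsSheaf (Precoverage.comap (proetAffineInclusion X)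
    (Scheme.ProEt.topology X).toPrecoverage).toGrothendieck _
  rw [Precoverage.isSheaf_toGrothendieck_iff]
  intro c c' g R₀ hR₀
  rw [Precoverage.mem_comap_iff, GrothendieckTopology.mem_toPrecoverage_iff] at hR₀
  haveI : CompactSpace ((proetAffineInclusion X).obj c).left := c.property.some.compactSpace
  obtain ⟨n, Y, φ, hφ, hsurj⟩ := exists_finite_of_mem_proEtTopology _ _ hR₀
  -- each `φ m` factors through (the image of) an arrow `q m ∈ R₀`
  have hq : ∀ m, ∃ (d : ProetAffine X) (q : d ⟶ c) (u : Y m ⟶ d.obj), R₀ q ∧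
      u ≫ (proetAffineInclusion X).map q = φ m := by
    intro m
    obtain ⟨d', u, q', hq', hfac⟩ := hφ m
    obtain ⟨d, rfl, q, hq, he⟩ := Presieve.map_iff.1 hq'
    rw [eqToHom_refl, Category.id_comp] at he
    exact ⟨d, q, u, hq, by rw [he, hfac]⟩
  choose d q u hRq hfac using hq
  have hqs : JointlySurjective X d q := by
    intro w
    obtain ⟨m, v, hv⟩ := hsurj w
    refine ⟨m, (u m).left.base v, ?_⟩
    rw [← hfac m] at hv
    exact hv
  -- the pulled-back sieve contains the base change of the `q m`, a finite jointly surjective family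
  refine Presieve.isSheafFor_subsieve (P := ((proetAffineInclusion X).op ⋙
      (etaleToProet X).op.lan.obj F.obj) ⋙ forget Ab.{u + 1})
    (S := Sieve.generate (Presieve.ofArrows (fun m => pullback (q m) g)
      (fun m => pullback.snd (q m) g))) ?_ ?_
  · change Sieve.generate _ ≤ Sieve.pullback g (Sieve.generate R₀)
    rw [Sieve.generate_le_iff]
    rintro _ _ ⟨m⟩
    change Sieve.generate R₀ (pullback.snd (q m) g ≫ g)
    rw [← pullback.condition]
    exact Sieve.downward_closed _ (Sieve.le_generate R₀ _ _ (hRq m)) _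
  · intro c'' k
    rw [← Sieve.pullbackArrows_comm, ← Presieve.ofArrows_pullback,
      ← Presieve.isSheafFor_iff_generate]
    exact isSheafFor_lan_ofArrows F _ _ ((hqs.pullback_snd g).pullback_snd k)

end Literature.AlgebraicGeometry.Motives
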